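import Literature.NumberTheory.Sieve.MatomakiRadziwillIntervals
import Literature.NumberTheory.Sieve.IntervalSieveBound
import Mathlib.MeasureTheory.Function.Floor
import Mathlib.MeasureTheory.Integral.IntervalIntegral.Basic
import Mathlib.MeasureTheory.Integral.Bochner.Set
import Mathlib.Analysis.SpecialFunctions.Pow.Real
import Mathlib.Analysis.SpecialFunctions.Log.Monotone
import HarnessLib

/-!
# Matomäki–Radziwiłł 2016: Theorem 1 from Theorem 3 (§9 of the paper, proved)

Topic `NumberTheory/Sieve`.  `MatomakiRadziwill.lean` vendors Theorem 1 of Matomäki–Radziwiłł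
(`MatomakiRadziwill2016_theorem1`, a named fact; its qualitative corollary is
`Literature.NumberTheory.Sieve.matomaki_radziwill`, parity.S38, via the proved `matomaki_radziwill_of_theorem1`) and
Theorem 3 (`MatomakiRadziwill2016_theorem3`, the mean-square estimate on the sieved set `𝒮`).
This file **proves** the deduction of §9 of the paper:

* `MatomakiRadziwill2016_theorem1_of_theorem3 : MatomakiRadziwill2016_theorem3 → MatomakiRadziwill2016_theorem1`,
* `matomaki_radziwill_of_theorem3 : MatomakiRadziwill2016_theorem3 → matomaki_radziwill`,

so that the named-fact frontier below `matomaki_radziwill` is now Theorem 3 alone (itself reduced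
in the paper to Lemma 14 + Proposition 1 + Lemmas 4, 5).

## The argument (§9, "Proof of Theorem 1") and its formal rendering

Write `A_g(x) = h⁻¹ ∑_{x ≤ n ≤ x+h} g(n)`, `B_g = X⁻¹ ∑_{X ≤ n ≤ 2X} g(n)`, `g_𝒮 = g·1_𝒮`.

1. *Separating `n ∉ 𝒮`* (`abs_sub_le_separate`, the first two displays of the proof):
   `|A_f(x) - B_f| ≤ |A_{f_𝒮}(x) - B_{f_𝒮}| + |A_{1_𝒮}(x) - B_{1_𝒮}| + 2 X⁻¹ #{n ∉ 𝒮} + O(1/h)`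
   (the `O(1/h)` is the explicit `2/h` of `inv_mul_card_window_sub_le`).
2. *Theorem 3 applied to `f` and to `1`, plus Chebyshev* (`card_filter_lt_abs_le_integral`,
   `card_exceptions_le_of_meanSquare`): Theorem 3 bounds `X⁻¹ ∫_X^{2X} |A_{g_𝒮}(y) - B_{g_𝒮}|² dy`
   over **real** `y`; an integer `x` with deviation `> t + 2/h` forces deviation `> t` for all real
   `y ∈ (x, x+1]` (the windows differ by at most two terms, `abs_window_sum_sub_le`), so the number
   of bad integers is `≤ t⁻² ∫ + 1`; measurability of the step function `y ↦ ∑_{y ≤ n ≤ y+h} g(n)` is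
   `measurable_window_sum`.  We take `t = δ/20` (the paper's "at most `δ/100`", any small fraction works).
3. *The sieve* (`inv_mul_card_not_mem_le`): `X⁻¹ #{X ≤ n ≤ 2X : n ∉ 𝒮} ≤ (1 + 1/100)·(7/4)·(log P_1/log Q_1) + (log X)^{-5/2}`,
   from the one-interval bound of `IntervalSieveBound.lean` summed over `j ≤ J ≤ √log X` with
   `∑_j log P_j / log Q_j = (log P_1/log Q_1) ∑_j j⁻² ≤ (7/4) log P_1 / log Q_1` for the choice (4)
   (`MatomakiRadziwillIntervals.lean`).
4. *Choice of the intervals* (`main_estimate`): `η = 1/150`; `Q_1 = h`, `P_1 = max(h^{δ/4}, (log h)^{K})`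
   if `h ≤ exp(√log X)`, and `Q_1 = exp(√log X)`, `P_1 = Q_1^{δ/4}` otherwise (valid as
   `δ ≥ (log X)^{-1/100}`), uniformly written `log Q_1 = L = min(log h, √log X)`,
   `log P_1 = p = max(δL/4, K log L)` with `K = 30000` (paper: `40/η = 6000`; only the size of the
   resulting absolute constant `C'` changes).  Then `P_1^{1/6-η} = P_1^{4/25} ≥ h^{δ/25}` in the
   first case and `(log h)^{1/3}/P_1^{4/25} ≤ (log X)^{-1/50}` in the second (`logh_rpow_div_le`),
   while `log P_1/log Q_1 ≤ δ/4 + K log log h/log h` in both (`p_div_L_le`).  The `δ`-budget is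
   `2t/δ + 2(1 + 1/100)(7/4)/4 = 1/10 + 0.88375 < 1`; everything else is `≤ C' log log h / log h`
   with `C' = 4K = 120000`, and the count of exceptions is `≤ (1600 C₃⁺ + 1) X (…)` where `C₃` is
   the constant of Theorem 3.
5. *Degenerate regimes* (`theorem1_of_theorem3`): `δ ≥ 3 + 2C'` — no exceptions at all
   (`|A_f - B_f| ≤ 3`, `log log h/log h ≥ -2`); `h < h₀` — the bound exceeds `(3/2) X ≥ #[X,2X]∩ℤ`
   through the term `(log h)^{1/3}/(δ² h^{δ/25})`; `h ≥ h₀, δ ≥ 3` — no exceptions;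
   `δ < (log X)^{-1/100}` — the bound exceeds `X` through `1/(δ² (log X)^{1/50})`; otherwise the main
   regime.  The thresholds `h₀` (and `X ≥ h`) come from `eventually_largeL`, `eventually_largeX`.

Theorem 1 is obtained with `C' = 120000` (the paper: `20000`) and an unspecified absolute `C`, as
the vendored statement `∃ C C' > 1, …` requires.

## References

* K. Matomäki, M. Radziwiłł, *Multiplicative functions in short intervals*, Ann. of Math. (2)
  183 (2016), 1015–1056, doi:10.4007/annals.2016.183.3.6 (arXiv:1501.04585): Theorem 1 (p. 1),
  §2 (the set `𝒮`, choice (4)), Theorem 3 (§2), and §9 "Proofs of Theorems 1 and 3", proof of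
  Theorem 1 (arXiv pp. 19–20).

## Mathlib

Measure theory: `Nat.measurable_ceil/floor`, `measurable_of_countable`,
`Measure.integrableOn_of_bounded`, `integral_biUnion_finset`, `setIntegral_mono_set/_on`,
`intervalIntegral.integral_of_le`; analysis: `Real.log_div_self_antitoneOn`,
`isLittleO_log_rpow_atTop`, `Real.isLittleO_log_id_atTop`, `Real.rpow_*`;
`ArithmeticFunction.zeta` (as the multiplicative function `1`).
-/

noncomputable section

open Finset MeasureTheory Filter

namespace Literature.NumberTheory.Sieve

namespace MatomakiRadziwillThm1

open SieveIntervalSystem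

/-! ### Windows: sums over `[y, y+h]` for real `y ∈ [x, x+1]` versus the integer window at `x` -/

/-- `|∑_s g - ∑_t g| ≤ #(s \ t) + #(t \ s)` when `|g| ≤ 1`. [folklore] -/
theorem abs_sum_sub_sum_le (s t : Finset ℕ) (g : ℕ → ℝ) (hg : ∀ n, |g n| ≤ 1) :
    |∑ n ∈ s, g n - ∑ n ∈ t, g n| ≤ #(s \ t) + #(t \ s) := by
  classical
  rw [← Finset.sum_inter_add_sum_sdiff s t, ← Finset.sum_inter_add_sum_sdiff t s, Finset.inter_comm t s]
  have h1 : |∑ n ∈ s \ t, g n| ≤ #(s \ t) := by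
    calc |∑ n ∈ s \ t, g n| ≤ ∑ n ∈ s \ t, |g n| := Finset.abs_sum_le_sum_abs _ _
      _ ≤ ∑ n ∈ s \ t, (1 : ℝ) := Finset.sum_le_sum fun n _ => hg n
      _ = #(s \ t) := by simp
  have h2 : |∑ n ∈ t \ s, g n| ≤ #(t \ s) := by
    calc |∑ n ∈ t \ s, g n| ≤ ∑ n ∈ t \ s, |g n| := Finset.abs_sum_le_sum_abs _ _
      _ ≤ ∑ n ∈ t \ s, (1 : ℝ) := Finset.sum_le_sum fun n _ => hg n
      _ = #(t \ s) := by simp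
  calc |∑ n ∈ s ∩ t, g n + ∑ n ∈ s \ t, g n - (∑ n ∈ s ∩ t, g n + ∑ n ∈ t \ s, g n)|
      = |∑ n ∈ s \ t, g n - ∑ n ∈ t \ s, g n| := by ring_nf
    _ ≤ |∑ n ∈ s \ t, g n| + |∑ n ∈ t \ s, g n| := abs_sub _ _
    _ ≤ _ := add_le_add h1 h2

/-- For real `y ∈ [x, x+1]` (`x ∈ ℕ`) and `h ≥ 0`, the integer points of `[y, y+h]` and of
`[x, x + h]` differ by at most one point on each side. [folklore] -/
theorem card_window_sdiff_le {x : ℕ} {y h : ℝ} (hx : (x : ℝ) ≤ y) (hy : y ≤ x + 1) (hh : 0 ≤ h) :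
    #(Icc ⌈y⌉₊ ⌊y + h⌋₊ \ Icc x (x + ⌊h⌋₊)) ≤ 1 ∧
      #(Icc x (x + ⌊h⌋₊) \ Icc ⌈y⌉₊ ⌊y + h⌋₊) ≤ 1 := by
  have hy0 : 0 ≤ y := le_trans (Nat.cast_nonneg x) hx
  have h1 : x ≤ ⌈y⌉₊ := by exact_mod_cast hx.trans (Nat.le_ceil y)
  have h2 : ⌈y⌉₊ ≤ x + 1 := Nat.ceil_le.mpr (by exact_mod_cast hy)
  have h3 : x + ⌊h⌋₊ ≤ ⌊y + h⌋₊ := by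
    refine Nat.le_floor ?_
    push_cast
    linarith [Nat.floor_le hh]
  have h4 : ⌊y + h⌋₊ ≤ x + ⌊h⌋₊ + 1 := by
    have : ⌊y + h⌋₊ ≤ ⌊h + ((x + 1 : ℕ) : ℝ)⌋₊ := Nat.floor_le_floor (by push_cast; linarith)
    rw [Nat.floor_add_natCast hh] at this
    omega
  constructor
  · calc #(Icc ⌈y⌉₊ ⌊y + h⌋₊ \ Icc x (x + ⌊h⌋₊)) ≤ #({x + ⌊h⌋₊ + 1} : Finset ℕ) := by
          refine Finset.card_le_card fun n hn => ?_
          simp only [Finset.mem_sdiff, Finset.mem_Icc, not_and, not_le] at hn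
          simp only [Finset.mem_singleton]
          omega
      _ = 1 := Finset.card_singleton _
  · calc #(Icc x (x + ⌊h⌋₊) \ Icc ⌈y⌉₊ ⌊y + h⌋₊) ≤ #({x} : Finset ℕ) := by
          refine Finset.card_le_card fun n hn => ?_
          simp only [Finset.mem_sdiff, Finset.mem_Icc, not_and, not_le] at hn
          simp only [Finset.mem_singleton]
          omega
      _ = 1 := Finset.card_singleton _

/-- For real `y ∈ [x, x+1]` and `|g| ≤ 1`, the window sums `∑_{y ≤ n ≤ y+h} g(n)` and
`∑_{x ≤ n ≤ x+h} g(n)` differ by at most `2`. [folklore] -/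
theorem abs_window_sum_sub_le {x : ℕ} {y h : ℝ} (hx : (x : ℝ) ≤ y) (hy : y ≤ x + 1) (hh : 0 ≤ h)
    (g : ℕ → ℝ) (hg : ∀ n, |g n| ≤ 1) :
    |∑ n ∈ Icc ⌈y⌉₊ ⌊y + h⌋₊, g n - ∑ n ∈ Icc x (x + ⌊h⌋₊), g n| ≤ 2 := by
  have hs := abs_sum_sub_sum_le (Icc ⌈y⌉₊ ⌊y + h⌋₊) (Icc x (x + ⌊h⌋₊)) g hg
  have h' := card_window_sdiff_le hx hy hh
  have h1 : (#(Icc ⌈y⌉₊ ⌊y + h⌋₊ \ Icc x (x + ⌊h⌋₊)) : ℝ) ≤ 1 := by exact_mod_cast h'.1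
  have h2 : (#(Icc x (x + ⌊h⌋₊) \ Icc ⌈y⌉₊ ⌊y + h⌋₊) : ℝ) ≤ 1 := by exact_mod_cast h'.2
  linarith

/-! ### From a mean-square bound over real `x ∈ [X, 2X]` to a count of bad integers (Chebyshev) -/

/-- The window sum `y ↦ ∑_{y ≤ n ≤ y + h} g(n)` is a measurable step function. [folklore] -/
theorem measurable_window_sum (g : ℕ → ℝ) (h : ℝ) :
    Measurable (fun y : ℝ => ∑ n ∈ Icc ⌈y⌉₊ ⌊y + h⌋₊, g n) := by
  have hm : Measurable (fun y : ℝ => ((⌈y⌉₊ : ℕ), ⌊y + h⌋₊)) :=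
    Nat.measurable_ceil.prodMk (Nat.measurable_floor.comp (measurable_id.add_const h))
  exact (measurable_of_countable (fun q : ℕ × ℕ => ∑ n ∈ Icc q.1 q.2, g n)).comp hm

/-- **Chebyshev step.**  If `|g| ≤ 1`, `h, X ≥ 1`, `t > 0`, then the number of integers
`x ∈ [X, 2X]` with `|h⁻¹ ∑_{x ≤ n ≤ x+h} g(n) - c| > t + 2/h` is at most
`t⁻² ∫_X^{2X} (h⁻¹ ∑_{y ≤ n ≤ y+h} g(n) - c)² dy + 1`: for such `x < ⌊2X⌋` and every real
`y ∈ (x, x+1]` the deviation at `y` exceeds `t` (the two windows differ by at most two terms), and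
the intervals `(x, x+1] ⊂ (X, 2X]` are disjoint. [folklore] -/
theorem card_filter_lt_abs_le_integral (g : ℕ → ℝ) (hg : ∀ n, |g n| ≤ 1) (c : ℝ) {h X t : ℝ}
    (hh : 1 ≤ h) (hX : 1 ≤ X) (ht : 0 < t) :
    (#{x ∈ Icc ⌈X⌉₊ ⌊2 * X⌋₊ | t + 2 / h < |h⁻¹ * ∑ n ∈ Icc x (x + ⌊h⌋₊), g n - c|} : ℝ) ≤
      (t ^ 2)⁻¹ * (∫ y in X..2 * X, (h⁻¹ * ∑ n ∈ Icc ⌈y⌉₊ ⌊y + h⌋₊, g n - c) ^ 2) + 1 := by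
  classical
  set D : ℝ → ℝ := fun y => h⁻¹ * ∑ n ∈ Icc ⌈y⌉₊ ⌊y + h⌋₊, g n - c with hD
  have h0 : 0 < h := by linarith
  have hDm : Measurable D :=
    ((measurable_window_sum g h).const_mul h⁻¹).sub_const c
  have hFm : Measurable fun y => D y ^ 2 := hDm.pow_const 2
  -- a uniform bound for `D` on `(X, 2X]`
  set M : ℝ := h⁻¹ * (2 * X + h + 1) + |c| with hM
  have hbound : ∀ y ∈ Set.Ioc X (2 * X), |D y| ≤ M := by
    intro y hy
    have hy0 : 0 ≤ y := by linarith [hy.1]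
    have hs : |∑ n ∈ Icc ⌈y⌉₊ ⌊y + h⌋₊, g n| ≤ 2 * X + h + 1 := by
      calc |∑ n ∈ Icc ⌈y⌉₊ ⌊y + h⌋₊, g n| ≤ ∑ n ∈ Icc ⌈y⌉₊ ⌊y + h⌋₊, |g n| :=
            Finset.abs_sum_le_sum_abs _ _
        _ ≤ ∑ n ∈ Icc ⌈y⌉₊ ⌊y + h⌋₊, (1 : ℝ) := Finset.sum_le_sum fun n _ => hg n
        _ = #(Icc ⌈y⌉₊ ⌊y + h⌋₊) := by simp
        _ ≤ ⌊y + h⌋₊ + 1 := by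
            have : #(Icc ⌈y⌉₊ ⌊y + h⌋₊) ≤ ⌊y + h⌋₊ + 1 := by
              rw [Nat.card_Icc]; omega
            exact_mod_cast this
        _ ≤ 2 * X + h + 1 := by
            have := Nat.floor_le (show 0 ≤ y + h by linarith)
            linarith [hy.2]
    calc |D y| ≤ |h⁻¹ * ∑ n ∈ Icc ⌈y⌉₊ ⌊y + h⌋₊, g n| + |c| := abs_sub _ _
      _ = h⁻¹ * |∑ n ∈ Icc ⌈y⌉₊ ⌊y + h⌋₊, g n| + |c| := by
          rw [abs_mul, abs_of_pos (inv_pos.mpr h0)]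
      _ ≤ M := by
          rw [hM]
          gcongr
  have hInt : IntegrableOn (fun y => D y ^ 2) (Set.Ioc X (2 * X)) := by
    refine Measure.integrableOn_of_bounded (M := M ^ 2) measure_Ioc_lt_top.ne
      hFm.aestronglyMeasurable ?_
    refine (ae_restrict_iff' measurableSet_Ioc).mpr (Filter.Eventually.of_forall fun y hy => ?_)
    rw [Real.norm_eq_abs, abs_pow]
    have hb := hbound y hy
    have hMnn : 0 ≤ M := (abs_nonneg _).trans hb
    exact pow_le_pow_left₀ (abs_nonneg _) hb 2
  -- the bad integers, and those with `x + 1 ≤ 2X`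
  set bad := {x ∈ Icc ⌈X⌉₊ ⌊2 * X⌋₊ | t + 2 / h < |h⁻¹ * ∑ n ∈ Icc x (x + ⌊h⌋₊), g n - c|}
    with hbad
  set bad' := bad.filter (fun x : ℕ => (x : ℝ) + 1 ≤ 2 * X) with hbad'
  have hsub : bad ⊆ bad' ∪ {⌊2 * X⌋₊} := by
    intro x hx
    rw [Finset.mem_union, Finset.mem_singleton, hbad', Finset.mem_filter]
    have hx2 : x ≤ ⌊2 * X⌋₊ := (Finset.mem_Icc.mp (Finset.mem_filter.mp hx).1).2
    rcases lt_or_eq_of_le hx2 with hlt | heq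
    · left
      refine ⟨hx, ?_⟩
      have : x + 1 ≤ ⌊2 * X⌋₊ := hlt
      have h' := Nat.floor_le (show 0 ≤ 2 * X by linarith)
      exact_mod_cast (show ((x + 1 : ℕ) : ℝ) ≤ 2 * X by exact_mod_cast (le_trans (by exact_mod_cast this) h'))
    · right; exact heq
  have hcard : (#bad : ℝ) ≤ #bad' + 1 := by
    have := (Finset.card_le_card hsub).trans (Finset.card_union_le _ _)
    rw [Finset.card_singleton] at this
    exact_mod_cast this
  -- the pieces `(x, x+1]`
  have hpiece_sub : ∀ x ∈ bad', Set.Ioc (x : ℝ) (x + 1) ⊆ Set.Ioc X (2 * X) := by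
    intro x hx
    rw [hbad', Finset.mem_filter] at hx
    have hx1 : ⌈X⌉₊ ≤ x := (Finset.mem_Icc.mp (Finset.mem_filter.mp hx.1).1).1
    have hXx : X ≤ x := (Nat.le_ceil X).trans (by exact_mod_cast hx1)
    exact Set.Ioc_subset_Ioc hXx hx.2
  have hdisj : Set.Pairwise (↑bad' : Set ℕ) (Function.onFun Disjoint fun x : ℕ => Set.Ioc (x : ℝ) (x + 1)) := by
    intro x _ x' _ hne
    change Disjoint (Set.Ioc (x : ℝ) (x + 1)) (Set.Ioc (x' : ℝ) (x' + 1))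
    rw [Set.Ioc_disjoint_Ioc]
    rcases lt_or_gt_of_ne hne with hlt | hlt
    · have : (x : ℝ) + 1 ≤ x' := by exact_mod_cast hlt
      calc min ((x : ℝ) + 1) (x' + 1) ≤ x + 1 := min_le_left _ _
        _ ≤ x' := this
        _ ≤ max (x : ℝ) x' := le_max_right _ _
    · have : (x' : ℝ) + 1 ≤ x := by exact_mod_cast hlt
      calc min ((x : ℝ) + 1) (x' + 1) ≤ x' + 1 := min_le_right _ _
        _ ≤ x := this
        _ ≤ max (x : ℝ) x' := le_max_left _ _
  -- on each piece the integrand exceeds `t²`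
  have hlow : ∀ x ∈ bad', t ^ 2 ≤ ∫ y in Set.Ioc (x : ℝ) (x + 1), D y ^ 2 := by
    intro x hx
    have hxbad : t + 2 / h < |h⁻¹ * ∑ n ∈ Icc x (x + ⌊h⌋₊), g n - c| := by
      rw [hbad', Finset.mem_filter, hbad, Finset.mem_filter] at hx
      exact hx.1.2
    have hpt : ∀ y ∈ Set.Ioc (x : ℝ) (x + 1), t ^ 2 ≤ D y ^ 2 := by
      intro y hy
      have hw := abs_window_sum_sub_le hy.1.le hy.2 h0.le g hg
      have hdiff : |D y - (h⁻¹ * ∑ n ∈ Icc x (x + ⌊h⌋₊), g n - c)| ≤ 2 / h := by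
        have : D y - (h⁻¹ * ∑ n ∈ Icc x (x + ⌊h⌋₊), g n - c) =
            h⁻¹ * (∑ n ∈ Icc ⌈y⌉₊ ⌊y + h⌋₊, g n - ∑ n ∈ Icc x (x + ⌊h⌋₊), g n) := by
          rw [hD]; ring
        rw [this, abs_mul, abs_of_pos (inv_pos.mpr h0), div_eq_mul_inv, mul_comm (2 : ℝ)]
        exact mul_le_mul_of_nonneg_left hw (inv_pos.mpr h0).le
      have ht' : t < |D y| := by
        have := abs_sub_abs_le_abs_sub (h⁻¹ * ∑ n ∈ Icc x (x + ⌊h⌋₊), g n - c) (D y)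
        rw [abs_sub_comm (h⁻¹ * ∑ n ∈ Icc x (x + ⌊h⌋₊), g n - c) (D y)] at this
        have h2h : 2 / h ≥ 0 := by positivity
        linarith
      calc t ^ 2 ≤ |D y| ^ 2 := pow_le_pow_left₀ ht.le ht'.le 2
        _ = D y ^ 2 := sq_abs _
    have hIntx : IntegrableOn (fun y => D y ^ 2) (Set.Ioc (x : ℝ) (x + 1)) :=
      hInt.mono_set (hpiece_sub x hx)
    calc t ^ 2 = ∫ _ in Set.Ioc (x : ℝ) (x + 1), t ^ 2 := by
          rw [setIntegral_const, Real.volume_real_Ioc_of_le (by linarith), smul_eq_mul]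
          ring
      _ ≤ ∫ y in Set.Ioc (x : ℝ) (x + 1), D y ^ 2 :=
          setIntegral_mono_on (integrableOn_const measure_Ioc_lt_top.ne) hIntx
            measurableSet_Ioc hpt
  -- sum over the pieces
  have hsum : (#bad' : ℝ) * t ^ 2 ≤ ∫ y in X..2 * X, D y ^ 2 := by
    calc (#bad' : ℝ) * t ^ 2 = ∑ x ∈ bad', t ^ 2 := by simp
      _ ≤ ∑ x ∈ bad', ∫ y in Set.Ioc (x : ℝ) (x + 1), D y ^ 2 := Finset.sum_le_sum hlow
      _ = ∫ y in ⋃ x ∈ bad', Set.Ioc (x : ℝ) (x + 1), D y ^ 2 :=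
          (integral_biUnion_finset bad' (fun _ _ => measurableSet_Ioc) hdisj
            (fun x hx => hInt.mono_set (hpiece_sub x hx))).symm
      _ ≤ ∫ y in Set.Ioc X (2 * X), D y ^ 2 := by
          refine setIntegral_mono_set hInt ?_ (Filter.Eventually.of_forall ?_)
          · exact Filter.Eventually.of_forall fun y => sq_nonneg _
          · exact Set.iUnion₂_subset fun x hx => hpiece_sub x hx
      _ = ∫ y in X..2 * X, D y ^ 2 := (intervalIntegral.integral_of_le (by linarith)).symm
  have ht2 : 0 < t ^ 2 := by positivity
  have : (#bad' : ℝ) ≤ (t ^ 2)⁻¹ * ∫ y in X..2 * X, D y ^ 2 := by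
    rw [← le_div_iff₀ ht2, div_eq_inv_mul] at hsum
    exact hsum
  linarith

/-! ### Separating the contribution of `n ∉ 𝒮` -/

/-- `|∑_{s} f| ≤ #s` for `|f| ≤ 1`. [folklore] -/
theorem abs_sum_le_card (s : Finset ℕ) (f : ℕ → ℝ) (hf : ∀ n, |f n| ≤ 1) :
    |∑ n ∈ s, f n| ≤ #s := by
  calc |∑ n ∈ s, f n| ≤ ∑ n ∈ s, |f n| := Finset.abs_sum_le_sum_abs _ _
    _ ≤ ∑ n ∈ s, (1 : ℝ) := Finset.sum_le_sum fun n _ => hf n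
    _ = #s := by simp

/-- **Separating `n ∉ 𝒮`** (Matomäki–Radziwiłł, proof of Theorem 1, first two displays): for
`|f| ≤ 1`, weights `a, b ≥ 0` (`= 1/h, 1/X`) and finite ranges `s, L` (`= [x, x+h], [X, 2X]`),
`|a ∑_s f - b ∑_L f| ≤ |a ∑_{s ∩ 𝒮} f - b ∑_{L ∩ 𝒮} f| + |a #(s ∩ 𝒮) - b #(L ∩ 𝒮)|
  + 2 b #(L ∖ 𝒮) + (a #s - b #L)`.
[cite: MatomakiRadziwillAnnals2016, §9 (proof of Theorem 1)] -/
theorem abs_sub_le_separate (S : ℕ → Prop) [DecidablePred S] (f : ℕ → ℝ) (hf : ∀ n, |f n| ≤ 1)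
    (s L : Finset ℕ) {a b : ℝ} (ha : 0 ≤ a) (hb : 0 ≤ b) :
    |a * ∑ n ∈ s, f n - b * ∑ n ∈ L, f n| ≤
      |a * ∑ n ∈ s.filter S, f n - b * ∑ n ∈ L.filter S, f n|
      + |a * #(s.filter S) - b * #(L.filter S)|
      + 2 * (b * #(L.filter (fun n => ¬ S n))) + (a * #s - b * #L) := by
  have hs := (Finset.sum_filter_add_sum_filter_not s S f).symm
  have hL := (Finset.sum_filter_add_sum_filter_not L S f).symm
  have hcs : (#(s.filter S) : ℝ) + #(s.filter (fun n => ¬ S n)) = #s := by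
    exact_mod_cast Finset.card_filter_add_card_filter_not (s := s) S
  have hcL : (#(L.filter S) : ℝ) + #(L.filter (fun n => ¬ S n)) = #L := by
    exact_mod_cast Finset.card_filter_add_card_filter_not (s := L) S
  have h1 : |a * ∑ n ∈ s.filter (fun n => ¬ S n), f n| ≤ a * #(s.filter (fun n => ¬ S n)) := by
    rw [abs_mul, abs_of_nonneg ha]
    exact mul_le_mul_of_nonneg_left (abs_sum_le_card _ f hf) ha
  have h2 : |b * ∑ n ∈ L.filter (fun n => ¬ S n), f n| ≤ b * #(L.filter (fun n => ¬ S n)) := by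
    rw [abs_mul, abs_of_nonneg hb]
    exact mul_le_mul_of_nonneg_left (abs_sum_le_card _ f hf) hb
  have key : a * ∑ n ∈ s, f n - b * ∑ n ∈ L, f n =
      (a * ∑ n ∈ s.filter S, f n - b * ∑ n ∈ L.filter S, f n)
        + a * ∑ n ∈ s.filter (fun n => ¬ S n), f n - b * ∑ n ∈ L.filter (fun n => ¬ S n), f n := by
    rw [hs, hL]; ring
  have habs : |a * ∑ n ∈ s, f n - b * ∑ n ∈ L, f n| ≤
      |a * ∑ n ∈ s.filter S, f n - b * ∑ n ∈ L.filter S, f n|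
        + a * #(s.filter (fun n => ¬ S n)) + b * #(L.filter (fun n => ¬ S n)) := by
    rw [key]
    have t1 := abs_sub (a * ∑ n ∈ s.filter S, f n - b * ∑ n ∈ L.filter S, f n
        + a * ∑ n ∈ s.filter (fun n => ¬ S n), f n) (b * ∑ n ∈ L.filter (fun n => ¬ S n), f n)
    have t2 := abs_add_le (a * ∑ n ∈ s.filter S, f n - b * ∑ n ∈ L.filter S, f n)
        (a * ∑ n ∈ s.filter (fun n => ¬ S n), f n)
    linarith
  -- `a #(s ∖ 𝒮) = a #s - a #(s ∩ 𝒮)` and `a #(s ∩ 𝒮) ≥ b #(L ∩ 𝒮) - |…|`, `b #(L ∩ 𝒮) = b #L - b #(L ∖ 𝒮)`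
  have h3 : a * #(s.filter (fun n => ¬ S n)) ≤
      (a * #s - b * #L) + b * #(L.filter (fun n => ¬ S n))
        + |a * #(s.filter S) - b * #(L.filter S)| := by
    have e1 : a * #(s.filter (fun n => ¬ S n)) = a * #s - a * #(s.filter S) := by
      rw [← hcs]; ring
    have e2 : b * #(L.filter S) = b * #L - b * #(L.filter (fun n => ¬ S n)) := by
      rw [← hcL]; ring
    have e3 : b * #(L.filter S) - a * #(s.filter S) ≤ |a * #(s.filter S) - b * #(L.filter S)| := by
      rw [abs_sub_comm]; exact le_abs_self _
    linarith
  linarith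

/-- `(1/h) #[x, x+h] - (1/X) #[X, 2X] ≤ 2/h` for `2 ≤ h ≤ X` (`#[x,x+h] ≤ h + 1`, `#[X,2X] ≥ X - 1`).
[folklore] -/
theorem inv_mul_card_window_sub_le {h X : ℝ} (hh : 2 ≤ h) (hhX : h ≤ X) (x : ℕ) :
    h⁻¹ * #(Icc x (x + ⌊h⌋₊)) - X⁻¹ * #(Icc ⌈X⌉₊ ⌊2 * X⌋₊) ≤ 2 / h := by
  have h0 : 0 < h := by linarith
  have hX0 : 0 < X := by linarith
  have h1 : (#(Icc x (x + ⌊h⌋₊)) : ℝ) ≤ h + 1 := by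
    rw [Nat.card_Icc]
    have : ((x + ⌊h⌋₊ + 1 - x : ℕ) : ℝ) = ⌊h⌋₊ + 1 := by
      rw [show x + ⌊h⌋₊ + 1 - x = ⌊h⌋₊ + 1 by omega]; push_cast; ring
    rw [this]
    linarith [Nat.floor_le h0.le]
  have h2 : X - 1 ≤ (#(Icc ⌈X⌉₊ ⌊2 * X⌋₊) : ℝ) := by
    rw [Nat.card_Icc]
    have hc : (⌈X⌉₊ : ℝ) < X + 1 := Nat.ceil_lt_add_one hX0.le
    have hf : 2 * X < (⌊2 * X⌋₊ : ℝ) + 1 := Nat.lt_floor_add_one _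
    have hle : ⌈X⌉₊ ≤ ⌊2 * X⌋₊ + 1 := by
      have : (⌈X⌉₊ : ℝ) ≤ (⌊2 * X⌋₊ : ℝ) + 1 := by linarith
      exact_mod_cast this
    rw [Nat.cast_sub hle]
    push_cast
    linarith
  have e1 : h⁻¹ * #(Icc x (x + ⌊h⌋₊)) ≤ 1 + 1 / h := by
    calc h⁻¹ * #(Icc x (x + ⌊h⌋₊)) ≤ h⁻¹ * (h + 1) :=
          mul_le_mul_of_nonneg_left h1 (inv_pos.mpr h0).le
      _ = 1 + 1 / h := by field_simp
  have e2 : 1 - 1 / h ≤ X⁻¹ * #(Icc ⌈X⌉₊ ⌊2 * X⌋₊) := by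
    calc 1 - 1 / h ≤ 1 - 1 / X := by
          have : 1 / X ≤ 1 / h := one_div_le_one_div_of_le h0 hhX
          linarith
      _ = X⁻¹ * (X - 1) := by field_simp
      _ ≤ X⁻¹ * #(Icc ⌈X⌉₊ ⌊2 * X⌋₊) := mul_le_mul_of_nonneg_left h2 (inv_pos.mpr hX0).le
  have : 1 + 1 / h - (1 - 1 / h) = 2 / h := by ring
  linarith

/-- For an integer `x`, the real window `[x, x + h]` has the integer points `Icc x (x + ⌊h⌋₊)`:
`⌈(x : ℝ)⌉₊ = x` and `⌊(x : ℝ) + h⌋₊ = x + ⌊h⌋₊` (`h ≥ 0`). [folklore] -/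
theorem window_natCast (x : ℕ) {h : ℝ} (hh : 0 ≤ h) :
    Icc ⌈(x : ℝ)⌉₊ ⌊(x : ℝ) + h⌋₊ = Icc x (x + ⌊h⌋₊) := by
  rw [Nat.ceil_natCast, add_comm (x : ℝ) h, Nat.floor_add_natCast hh, add_comm]

/-! ### The two cases `h ≤ exp(√log X)` and `h > exp(√log X)` -/

/-- With `L = min(log h, √log X)` (`= log Q_1`) and `p = max(δL/4, 30000 log L)` (`= log P_1`):
`p / L ≤ δ/4 + 30000 · log log h / log h` — in the first case with `L = log h` directly, in the
second because then `p = δ L / 4`. [cite: MatomakiRadziwillAnnals2016, §9 (proof of Theorem 1, choice of `P_1, Q_1`)] -/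
theorem p_div_L_le {h u δ L p : ℝ} (hL : L = min (Real.log h) (Real.sqrt u))
    (hp : p = max (δ * L / 4) (30000 * Real.log L)) (hL0 : 0 < L) (hδ : 0 ≤ δ)
    (hlogh : 1 ≤ Real.log h)
    (hcase2 : Real.sqrt u < Real.log h → 30000 * Real.log L ≤ δ * L / 4) :
    p / L ≤ δ / 4 + 30000 * (Real.log (Real.log h) / Real.log h) := by
  have hll : 0 ≤ Real.log (Real.log h) := Real.log_nonneg hlogh
  have hlh0 : 0 < Real.log h := by linarith
  rcases le_or_gt (Real.log h) (Real.sqrt u) with h1 | h1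
  · -- case `h ≤ exp(√log X)`: `L = log h`
    have hL' : L = Real.log h := by rw [hL, min_eq_left h1]
    rw [hp, hL']
    rcases le_total (δ * Real.log h / 4) (30000 * Real.log (Real.log h)) with h2 | h2
    · rw [max_eq_right h2]
      have : 30000 * Real.log (Real.log h) / Real.log h = 30000 * (Real.log (Real.log h) / Real.log h) := by
        ring
      rw [this]
      linarith
    · rw [max_eq_left h2]
      have : δ * Real.log h / 4 / Real.log h = δ / 4 := by field_simp
      rw [this]
      have : 0 ≤ Real.log (Real.log h) / Real.log h := by positivity
      linarith
  · -- case `h > exp(√log X)`: `p = δ L / 4`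
    have hp' : p = δ * L / 4 := by rw [hp, max_eq_left (hcase2 h1)]
    rw [hp']
    have : δ * L / 4 / L = δ / 4 := by field_simp
    rw [this]
    have : 0 ≤ Real.log (Real.log h) / Real.log h := by positivity
    linarith

/-- The exceptional-set factor: with `L, p` as above, `u = log X`, `δ ≥ u^{-1/100}` and `X` large,
`(log h)^{1/3} / P_1^{1/6 - η} ≤ (log h)^{1/3} / h^{δ/25} + (log X)^{-1/50}` (`η = 1/150`,
`P_1 = e^p`): in the first case `P_1 ≥ h^{δ/4}` and `P_1^{4/25} ≥ h^{δ/25}`; in the second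
`P_1^{4/25} ≥ exp((δ/25) √log X) ≥ exp((log X)^{49/100}/25)`, which beats `(log X)^{1/3 + 1/50}`.
[cite: MatomakiRadziwillAnnals2016, §9 (proof of Theorem 1, "the number of exceptions is as claimed")] -/
theorem logh_rpow_div_le {h u δ L p : ℝ} (hL : L = min (Real.log h) (Real.sqrt u))
    (hpL : δ * L / 4 ≤ p) (hh : 1 < h) (hu : Real.log h ≤ u)
    (hδu : u ^ (-(1 / 100) : ℝ) ≤ δ)
    (hu5 : u ^ (1 / 3 + 1 / 50 : ℝ) ≤ Real.exp (u ^ (49 / 100 : ℝ) / 25)) :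
    Real.log h ^ (1 / 3 : ℝ) / Real.exp p ^ (1 / 6 - 1 / 150 : ℝ) ≤
      Real.log h ^ (1 / 3 : ℝ) / h ^ (δ / 25) + 1 / u ^ (1 / 50 : ℝ) := by
  have hlh : 0 < Real.log h := Real.log_pos hh
  have hu0 : 0 < u := by linarith
  have h0 : 0 < h := by linarith
  have hA : 0 ≤ Real.log h ^ (1 / 3 : ℝ) := Real.rpow_nonneg hlh.le _
  have hB : 0 ≤ 1 / u ^ (1 / 50 : ℝ) := by positivity
  have hexp : Real.exp p ^ (1 / 6 - 1 / 150 : ℝ) = Real.exp (4 / 25 * p) := by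
    rw [← Real.exp_mul]; norm_num; ring_nf
  rw [hexp]
  rcases le_or_gt (Real.log h) (Real.sqrt u) with h1 | h1
  · -- `L = log h`, `e^{4p/25} ≥ h^{δ/25}`
    have hL' : L = Real.log h := by rw [hL, min_eq_left h1]
    have hge : h ^ (δ / 25) ≤ Real.exp (4 / 25 * p) := by
      rw [Real.rpow_def_of_pos h0]
      exact Real.exp_le_exp.mpr (by rw [hL'] at hpL; nlinarith)
    have : Real.log h ^ (1 / 3 : ℝ) / Real.exp (4 / 25 * p) ≤ Real.log h ^ (1 / 3 : ℝ) / h ^ (δ / 25) :=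
      div_le_div_of_nonneg_left hA (Real.rpow_pos_of_pos h0 _) hge
    linarith
  · -- `L = √u`, `4p/25 ≥ u^{49/100}/25`
    have hL' : L = Real.sqrt u := by rw [hL, min_eq_right h1.le]
    have hsq : Real.sqrt u = u ^ (1 / 2 : ℝ) := Real.sqrt_eq_rpow u
    have h49 : u ^ (49 / 100 : ℝ) ≤ δ * L := by
      rw [hL', hsq]
      have : u ^ (49 / 100 : ℝ) = u ^ (-(1 / 100) : ℝ) * u ^ (1 / 2 : ℝ) := by
        rw [← Real.rpow_add hu0]; norm_num
      rw [this]
      exact mul_le_mul_of_nonneg_right hδu (Real.rpow_nonneg hu0.le _)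
    have hE : Real.exp (-(4 / 25 * p)) ≤ Real.exp (-(u ^ (49 / 100 : ℝ) / 25)) :=
      Real.exp_le_exp.mpr (by linarith)
    have hlogh3 : Real.log h ^ (1 / 3 : ℝ) ≤ u ^ (1 / 3 : ℝ) :=
      Real.rpow_le_rpow hlh.le hu (by norm_num)
    have hsplit : u ^ (1 / 3 : ℝ) = u ^ (1 / 3 + 1 / 50 : ℝ) * u ^ (-(1 / 50) : ℝ) := by
      rw [← Real.rpow_add hu0]; norm_num
    have hneg : u ^ (-(1 / 50) : ℝ) = 1 / u ^ (1 / 50 : ℝ) := by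
      rw [Real.rpow_neg hu0.le, inv_eq_one_div]
    calc Real.log h ^ (1 / 3 : ℝ) / Real.exp (4 / 25 * p)
        = Real.log h ^ (1 / 3 : ℝ) * Real.exp (-(4 / 25 * p)) := by
          rw [Real.exp_neg, div_eq_mul_inv]
      _ ≤ u ^ (1 / 3 : ℝ) * Real.exp (-(u ^ (49 / 100 : ℝ) / 25)) :=
          mul_le_mul hlogh3 hE (Real.exp_pos _).le (Real.rpow_nonneg hu0.le _)
      _ = u ^ (1 / 3 + 1 / 50 : ℝ) * Real.exp (-(u ^ (49 / 100 : ℝ) / 25)) * u ^ (-(1 / 50) : ℝ) := by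
          rw [hsplit]; ring
      _ ≤ Real.exp (u ^ (49 / 100 : ℝ) / 25) * Real.exp (-(u ^ (49 / 100 : ℝ) / 25))
            * u ^ (-(1 / 50) : ℝ) := by
          gcongr
      _ = 1 / u ^ (1 / 50 : ℝ) := by
          rw [← Real.exp_add, add_neg_cancel, Real.exp_zero, one_mul, hneg]
      _ ≤ _ := by
          have : 0 ≤ Real.log h ^ (1 / 3 : ℝ) / h ^ (δ / 25) := by positivity
          linarith

/-! ### Counting exceptions from the two mean-square bounds -/

/-- **From mean squares to exceptions** (the combinatorial heart of §9): let `𝒮 ⊂ ℕ`, `|f| ≤ 1`,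
`2 ≤ h ≤ X`, `t > 0`; write `A_g(x) = h⁻¹ ∑_{x ≤ n ≤ x+h} g(n)`, `B_g = X⁻¹ ∑_{X ≤ n ≤ 2X} g(n)` and
`g_𝒮 = g · 1_𝒮`.  If `X⁻¹ #{X ≤ n ≤ 2X : n ∉ 𝒮} ≤ σ` and `τ ≥ 2t + 6/h + 2σ`, then
`#{x ∈ [X, 2X] ∩ ℤ : |A_f(x) - B_f| > τ}
  ≤ t⁻² (∫_X^{2X} |A_{f_𝒮}(y) - B_{f_𝒮}|² dy + ∫_X^{2X} |A_{1_𝒮}(y) - B_{1_𝒮}|² dy) + 2`: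
by `abs_sub_le_separate`, an exception is bad for `f_𝒮` or for `1_𝒮` at level `t + 2/h`, and the
bad integers are counted by `card_filter_lt_abs_le_integral`.
[cite: MatomakiRadziwillAnnals2016, §9 (proof of Theorem 1)] -/
theorem card_exceptions_le_of_meanSquare (S : ℕ → Prop) [DecidablePred S] (f : ℕ → ℝ)
    (hf : ∀ n, |f n| ≤ 1) {h X t σ τ Mf M1 : ℝ} (hh : 2 ≤ h) (hhX : h ≤ X) (ht : 0 < t)
    (hσ : X⁻¹ * #((Icc ⌈X⌉₊ ⌊2 * X⌋₊).filter (fun n => ¬ S n)) ≤ σ)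
    (hτ : 2 * t + 6 / h + 2 * σ ≤ τ)
    (hMf : ∫ y in X..2 * X, (h⁻¹ * ∑ n ∈ Icc ⌈y⌉₊ ⌊y + h⌋₊, (if S n then f n else 0)
        - X⁻¹ * ∑ n ∈ Icc ⌈X⌉₊ ⌊2 * X⌋₊, (if S n then f n else 0)) ^ 2 ≤ Mf)
    (hM1 : ∫ y in X..2 * X, (h⁻¹ * ∑ n ∈ Icc ⌈y⌉₊ ⌊y + h⌋₊, (if S n then (1 : ℝ) else 0)
        - X⁻¹ * ∑ n ∈ Icc ⌈X⌉₊ ⌊2 * X⌋₊, (if S n then (1 : ℝ) else 0)) ^ 2 ≤ M1) :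
    (#{x ∈ Icc ⌈X⌉₊ ⌊2 * X⌋₊ |
        τ < |h⁻¹ * ∑ n ∈ Icc x (x + ⌊h⌋₊), f n - X⁻¹ * ∑ n ∈ Icc ⌈X⌉₊ ⌊2 * X⌋₊, f n|} : ℝ)
      ≤ (t ^ 2)⁻¹ * (Mf + M1) + 2 := by
  classical
  set Lg := Icc ⌈X⌉₊ ⌊2 * X⌋₊ with hLg
  set g : ℕ → ℝ := fun n => if S n then f n else 0 with hg
  set u : ℕ → ℝ := fun n => if S n then (1 : ℝ) else 0 with hu
  have hg1 : ∀ n, |g n| ≤ 1 := fun n => by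
    simp only [hg]; split_ifs <;> simp [hf n]
  have hu1 : ∀ n, |u n| ≤ 1 := fun n => by
    simp only [hu]; split_ifs <;> simp
  have h0 : 0 < h := by linarith
  have hX0 : 0 < X := by linarith
  have h1 : (1 : ℝ) ≤ h := by linarith
  have hX1 : (1 : ℝ) ≤ X := by linarith
  set cg := X⁻¹ * ∑ n ∈ Lg, g n with hcg
  set cu := X⁻¹ * ∑ n ∈ Lg, u n with hcu
  set badg := {x ∈ Lg | t + 2 / h < |h⁻¹ * ∑ n ∈ Icc x (x + ⌊h⌋₊), g n - cg|} with hbadg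
  set badu := {x ∈ Lg | t + 2 / h < |h⁻¹ * ∑ n ∈ Icc x (x + ⌊h⌋₊), u n - cu|} with hbadu
  -- Chebyshev counts
  have hcg_count := card_filter_lt_abs_le_integral g hg1 cg h1 hX1 ht
  have hcu_count := card_filter_lt_abs_le_integral u hu1 cu h1 hX1 ht
  rw [← hLg] at hcg_count hcu_count
  -- exceptions are bad for `g` or for `u`
  have hsub : {x ∈ Lg | τ < |h⁻¹ * ∑ n ∈ Icc x (x + ⌊h⌋₊), f n - X⁻¹ * ∑ n ∈ Lg, f n|}
      ⊆ badg ∪ badu := by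
    intro x hx
    rw [Finset.mem_filter] at hx
    obtain ⟨hxL, hxτ⟩ := hx
    by_contra hnot
    rw [Finset.mem_union, not_or, hbadg, hbadu, Finset.mem_filter, Finset.mem_filter] at hnot
    obtain ⟨hng, hnu⟩ := hnot
    have hng' : |h⁻¹ * ∑ n ∈ Icc x (x + ⌊h⌋₊), g n - cg| ≤ t + 2 / h := by
      by_contra hc; exact hng ⟨hxL, lt_of_not_ge hc⟩
    have hnu' : |h⁻¹ * ∑ n ∈ Icc x (x + ⌊h⌋₊), u n - cu| ≤ t + 2 / h := by
      by_contra hc; exact hnu ⟨hxL, lt_of_not_ge hc⟩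
    have hsep := abs_sub_le_separate S f hf (Icc x (x + ⌊h⌋₊)) Lg (inv_pos.mpr h0).le
      (inv_pos.mpr hX0).le
    -- rewrite the filtered sums as sums of `g`, `u`
    have e1 : ∑ n ∈ (Icc x (x + ⌊h⌋₊)).filter S, f n = ∑ n ∈ Icc x (x + ⌊h⌋₊), g n :=
      Finset.sum_filter _ _
    have e2 : ∑ n ∈ Lg.filter S, f n = ∑ n ∈ Lg, g n := Finset.sum_filter _ _
    have e3 : (#((Icc x (x + ⌊h⌋₊)).filter S) : ℝ) = ∑ n ∈ Icc x (x + ⌊h⌋₊), u n := by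
      rw [Finset.card_filter]; push_cast; rfl
    have e4 : (#(Lg.filter S) : ℝ) = ∑ n ∈ Lg, u n := by
      rw [Finset.card_filter]; push_cast; rfl
    rw [e1, e2, e3, e4] at hsep
    have hwin := inv_mul_card_window_sub_le hh hhX x
    rw [← hLg] at hwin
    have : |h⁻¹ * ∑ n ∈ Icc x (x + ⌊h⌋₊), f n - X⁻¹ * ∑ n ∈ Lg, f n| ≤ τ := by
      calc |h⁻¹ * ∑ n ∈ Icc x (x + ⌊h⌋₊), f n - X⁻¹ * ∑ n ∈ Lg, f n|
          ≤ (t + 2 / h) + (t + 2 / h) + 2 * σ + 2 / h := by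
            refine hsep.trans ?_
            gcongr
        _ = 2 * t + 6 / h + 2 * σ := by ring
        _ ≤ τ := hτ
    linarith
  -- assemble
  have hcard : (#{x ∈ Lg | τ < |h⁻¹ * ∑ n ∈ Icc x (x + ⌊h⌋₊), f n - X⁻¹ * ∑ n ∈ Lg, f n|} : ℝ)
      ≤ #badg + #badu := by
    exact_mod_cast (Finset.card_le_card hsub).trans (Finset.card_union_le _ _)
  have ht2 : 0 < (t ^ 2)⁻¹ := by positivity
  have hg_int : (#badg : ℝ) ≤ (t ^ 2)⁻¹ * Mf + 1 := by
    refine hcg_count.trans ?_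
    gcongr
  have hu_int : (#badu : ℝ) ≤ (t ^ 2)⁻¹ * M1 + 1 := by
    refine hcu_count.trans ?_
    gcongr
  calc _ ≤ (#badg : ℝ) + #badu := hcard
    _ ≤ ((t ^ 2)⁻¹ * Mf + 1) + ((t ^ 2)⁻¹ * M1 + 1) := add_le_add hg_int hu_int
    _ = (t ^ 2)⁻¹ * (Mf + M1) + 2 := by ring


/-! ### The sieve step: `X⁻¹ #{X ≤ n ≤ 2X : n ∉ 𝒮}` for the choice (4) -/

/-- `p ≤ log P_j` for the choice (4) (`L ≥ 1`, `p ≥ 0`, `j ≥ 1`), i.e. `P_1 ≤ P_j`. [folklore] -/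
theorem le_choiceLogP {L p : ℝ} (hL : 1 ≤ L) (hp : 0 ≤ p) {j : ℕ} (hj : 1 ≤ j) :
    p ≤ choiceLogP L p j := by
  unfold choiceLogP
  have hj' : (1 : ℝ) ≤ j := by exact_mod_cast hj
  have h1 : (1 : ℝ) ≤ (j : ℝ) ^ (4 * j) * L ^ (j - 1) :=
    one_le_mul_of_one_le_of_one_le (one_le_pow₀ hj') (one_le_pow₀ hL)
  calc p = 1 * p := (one_mul p).symm
    _ ≤ (j : ℝ) ^ (4 * j) * L ^ (j - 1) * p := mul_le_mul_of_nonneg_right h1 hp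

/-- `n ∉ 𝒮` (`n ≠ 0`) means: for some `j ≤ J`, no prime of `[P_j, Q_j]` divides `n`. [folklore] -/
theorem filter_not_mem_subset_biUnion {η X : ℝ} (I : SieveIntervalSystem η X) (s : Finset ℕ)
    (hs : 0 ∉ s) :
    s.filter (fun n => ¬ I.Mem n) ⊆
      (Icc 1 I.J).biUnion (fun j =>
        s.filter (fun n => ∀ q ∈ (Icc ⌈I.P j⌉₊ ⌊I.Q j⌋₊).filter Nat.Prime, ¬ q ∣ n)) := by
  intro n hn
  rw [Finset.mem_filter] at hn
  obtain ⟨hns, hnot⟩ := hn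
  have hn0 : n ≠ 0 := fun h => hs (h ▸ hns)
  simp only [SieveIntervalSystem.Mem, not_forall, not_exists, not_and, exists_prop] at hnot
  obtain ⟨j, hj, hj'⟩ := hnot
  rw [Finset.mem_biUnion]
  refine ⟨j, hj, Finset.mem_filter.mpr ⟨hns, fun q hq hqn => ?_⟩⟩
  rw [Finset.mem_filter, Finset.mem_Icc] at hq
  obtain ⟨⟨hq1, hq2⟩, hqp⟩ := hq
  have hqf : q ∈ n.primeFactors := Nat.mem_primeFactors.mpr ⟨hqp, hqn, hn0⟩
  have hPq : I.P j ≤ q := (Nat.le_ceil _).trans (by exact_mod_cast hq1)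
  have hQ0 : 0 ≤ I.Q j := (I.pos_Q (Finset.mem_Icc.mp hj).1).le
  have hqQ : (q : ℝ) ≤ I.Q j := (Nat.le_floor_iff hQ0).mp hq2
  exact hj' q hqf hPq hqQ

/-- **The sieve step** (Matomäki–Radziwiłł §9: "by the fundamental lemma of the sieve,
`∑_{X ≤ n ≤ 2X, n ∉ 𝒮} 1 ≤ (1 + 1/100) X ∑_{j ≤ J} … ≤ (1 + 1/100) X ∑_{j ≤ J} log P_j / log Q_j`"),
for the system of choice (4): given the one-interval sieve bound `HB` (proved in
`IntervalSieveBound.lean`) with thresholds `X_B, P₀`,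
`X⁻¹ #{X ≤ n ≤ 2X : n ∉ 𝒮} ≤ (1 + 1/100) (7/4) p/L + √(log X)/(log X)³` (the last term is
`J · (log X)⁻³` with `J ≤ √log X`). [cite: MatomakiRadziwillAnnals2016, §9 (proof of Theorem 1)] -/
theorem inv_mul_card_not_mem_le {X L p : ℝ} (hL : 1 ≤ Real.log L) (hp : 30000 * Real.log L ≤ p)
    (hpL : p ≤ L) (hLX : L ≤ Real.sqrt (Real.log X)) {X_B P₀ : ℝ} (hP₀ : 0 < P₀)
    (HB : ∀ X P Q : ℝ, X_B ≤ X → P₀ ≤ P → P ≤ Q → Q ≤ Real.exp (Real.sqrt (Real.log X)) →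
      (#{n ∈ Icc ⌈X⌉₊ ⌊2 * X⌋₊ | ∀ q ∈ (Icc ⌈P⌉₊ ⌊Q⌋₊).filter Nat.Prime, ¬ q ∣ n} : ℝ) ≤
        (1 + 1 / 100) * X * (Real.log P / Real.log Q) + X / Real.log X ^ 3)
    (hXB : X_B ≤ X) (hX : 1 ≤ X) (hP₀p : Real.log P₀ ≤ p) :
    X⁻¹ * #((Icc ⌈X⌉₊ ⌊2 * X⌋₊).filter (fun n => ¬ (ofChoice X L p hL hp hpL hLX).Mem n))
      ≤ (1 + 1 / 100) * (7 / 4) * (p / L) + Real.sqrt (Real.log X) / Real.log X ^ 3 := by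
  set I := ofChoice X L p hL hp hpL hLX with hI
  set Lg := Icc ⌈X⌉₊ ⌊2 * X⌋₊ with hLg
  have hX0 : 0 < X := by linarith
  have hL1 : 1 ≤ L := by linarith
  have hp0 : 0 ≤ p := by
    have : 0 ≤ Real.log L := by linarith
    linarith
  have h0 : 0 ∉ Lg := by
    rw [hLg, Finset.mem_Icc, not_and_or]
    left
    have : 1 ≤ ⌈X⌉₊ := Nat.one_le_iff_ne_zero.mpr (by
      intro h; rw [Nat.ceil_eq_zero] at h; linarith)
    omega
  -- Step 1–2: union bound over `j ≤ J`
  have hcard : (#(Lg.filter (fun n => ¬ I.Mem n)) : ℝ) ≤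
      ∑ j ∈ Icc 1 I.J, (#(Lg.filter (fun n =>
        ∀ q ∈ (Icc ⌈I.P j⌉₊ ⌊I.Q j⌋₊).filter Nat.Prime, ¬ q ∣ n)) : ℝ) := by
    have := (Finset.card_le_card (filter_not_mem_subset_biUnion I Lg h0)).trans
      Finset.card_biUnion_le
    exact_mod_cast this
  -- Step 3: each term by `HB`
  have hterm : ∀ j ∈ Icc 1 I.J,
      (#(Lg.filter (fun n => ∀ q ∈ (Icc ⌈I.P j⌉₊ ⌊I.Q j⌋₊).filter Nat.Prime, ¬ q ∣ n)) : ℝ) ≤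
        (1 + 1 / 100) * X * (Real.log (I.P j) / Real.log (I.Q j)) + X / Real.log X ^ 3 := by
    intro j hj
    have hj1 : 1 ≤ j := (Finset.mem_Icc.mp hj).1
    have hjJ : j ≤ I.J := (Finset.mem_Icc.mp hj).2
    refine HB X (I.P j) (I.Q j) hXB ?_ (I.P_le_Q j hj1) ?_
    · -- `P₀ ≤ e^p ≤ P_j`
      calc P₀ = Real.exp (Real.log P₀) := (Real.exp_log hP₀).symm
        _ ≤ Real.exp p := Real.exp_le_exp.mpr hP₀p
        _ ≤ I.P j := by
            rw [hI, ofChoice_P]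
            exact Real.exp_le_exp.mpr (le_choiceLogP hL1 hp0 hj1)
    · -- `Q_j ≤ Q_J ≤ exp(√log X)`
      rcases eq_or_lt_of_le hjJ with h | h
      · rw [h]; exact I.Q_J_le
      · exact (I.Q_lt_Q (by norm_num) (by norm_num) hj1 h).le.trans I.Q_J_le
  -- Step 4: sum up
  have hsum : ∑ j ∈ Icc 1 I.J, ((1 + 1 / 100) * X * (Real.log (I.P j) / Real.log (I.Q j))
      + X / Real.log X ^ 3) ≤ (1 + 1 / 100) * X * (7 / 4 * (p / L)) + Real.sqrt (Real.log X) * (X / Real.log X ^ 3) := by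
    rw [Finset.sum_add_distrib, ← Finset.mul_sum, Finset.sum_const, Nat.card_Icc, nsmul_eq_mul]
    have hJ : ((I.J + 1 - 1 : ℕ) : ℝ) ≤ Real.sqrt (Real.log X) := by
      rw [Nat.add_sub_cancel]; exact ofChoice_J_le hL hp hpL hLX
    have hS := ofChoice_sum_log_div_log_le hL hp hpL hLX
    have hXl : 0 ≤ X / Real.log X ^ 3 := by
      have : 0 ≤ Real.log X := Real.log_nonneg hX
      positivity
    gcongr
  have hfin : (#(Lg.filter (fun n => ¬ I.Mem n)) : ℝ) ≤
      (1 + 1 / 100) * X * (7 / 4 * (p / L)) + Real.sqrt (Real.log X) * (X / Real.log X ^ 3) :=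
    (hcard.trans (Finset.sum_le_sum hterm)).trans hsum
  calc X⁻¹ * #(Lg.filter (fun n => ¬ I.Mem n))
      ≤ X⁻¹ * ((1 + 1 / 100) * X * (7 / 4 * (p / L)) + Real.sqrt (Real.log X) * (X / Real.log X ^ 3)) :=
        mul_le_mul_of_nonneg_left hfin (inv_pos.mpr hX0).le
    _ = (1 + 1 / 100) * (7 / 4) * (p / L) + Real.sqrt (Real.log X) / Real.log X ^ 3 := by
        field_simp


/-! ### Small lemmas for the bookkeeping -/

/-- `#([X, 2X] ∩ ℤ) ≤ X + 1` (`X ≥ 1`). [folklore] -/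
theorem card_long_le {X : ℝ} (hX : 1 ≤ X) : (#(Icc ⌈X⌉₊ ⌊2 * X⌋₊) : ℝ) ≤ X + 1 := by
  rw [Nat.card_Icc]
  have hc : X ≤ (⌈X⌉₊ : ℝ) := Nat.le_ceil X
  have hf : (⌊2 * X⌋₊ : ℝ) ≤ 2 * X := Nat.floor_le (by linarith)
  have hle : ⌈X⌉₊ ≤ ⌊2 * X⌋₊ + 1 := by
    have h1 : (⌈X⌉₊ : ℝ) < X + 1 := Nat.ceil_lt_add_one (by linarith)
    have h2 : 2 * X < (⌊2 * X⌋₊ : ℝ) + 1 := Nat.lt_floor_add_one _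
    have : (⌈X⌉₊ : ℝ) ≤ (⌊2 * X⌋₊ : ℝ) + 1 := by linarith
    exact_mod_cast this
  rw [Nat.cast_sub hle]
  push_cast
  linarith

/-- `#([X, 2X] ∩ ℤ) ≤ (3/2) X` for `X ≥ 2`. [folklore] -/
theorem card_long_le' {X : ℝ} (hX : 2 ≤ X) : (#(Icc ⌈X⌉₊ ⌊2 * X⌋₊) : ℝ) ≤ 3 / 2 * X := by
  have := card_long_le (show 1 ≤ X by linarith)
  linarith

/-- The trivial bound `|A_f(x) - B_f| ≤ 3` (`|A_f| ≤ (h+1)/h ≤ 3/2`, `|B_f| ≤ (X+1)/X ≤ 3/2`).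
[folklore] -/
theorem abs_avg_sub_avg_le_three (f : ℕ → ℝ) (hf : ∀ n, |f n| ≤ 1) {h X : ℝ} (hh : 2 ≤ h)
    (hhX : h ≤ X) (x : ℕ) :
    |h⁻¹ * ∑ n ∈ Icc x (x + ⌊h⌋₊), f n - X⁻¹ * ∑ n ∈ Icc ⌈X⌉₊ ⌊2 * X⌋₊, f n| ≤ 3 := by
  have h0 : 0 < h := by linarith
  have hX0 : 0 < X := by linarith
  have h1 : |h⁻¹ * ∑ n ∈ Icc x (x + ⌊h⌋₊), f n| ≤ 3 / 2 := by
    rw [abs_mul, abs_of_pos (inv_pos.mpr h0)]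
    have hs := abs_sum_le_card (Icc x (x + ⌊h⌋₊)) f hf
    have hc : (#(Icc x (x + ⌊h⌋₊)) : ℝ) ≤ h + 1 := by
      rw [Nat.card_Icc, show x + ⌊h⌋₊ + 1 - x = ⌊h⌋₊ + 1 by omega]
      push_cast
      linarith [Nat.floor_le h0.le]
    calc h⁻¹ * |∑ n ∈ Icc x (x + ⌊h⌋₊), f n| ≤ h⁻¹ * (h + 1) :=
          mul_le_mul_of_nonneg_left (hs.trans hc) (inv_pos.mpr h0).le
      _ = 1 + 1 / h := by field_simp
      _ ≤ 3 / 2 := by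
          have : 1 / h ≤ 1 / 2 := one_div_le_one_div_of_le (by norm_num) hh
          linarith
  have h2 : |X⁻¹ * ∑ n ∈ Icc ⌈X⌉₊ ⌊2 * X⌋₊, f n| ≤ 3 / 2 := by
    rw [abs_mul, abs_of_pos (inv_pos.mpr hX0)]
    have hs := abs_sum_le_card (Icc ⌈X⌉₊ ⌊2 * X⌋₊) f hf
    have hc := card_long_le (show 1 ≤ X by linarith)
    calc X⁻¹ * |∑ n ∈ Icc ⌈X⌉₊ ⌊2 * X⌋₊, f n| ≤ X⁻¹ * (X + 1) :=
          mul_le_mul_of_nonneg_left (hs.trans hc) (inv_pos.mpr hX0).le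
      _ = 1 + 1 / X := by field_simp
      _ ≤ 3 / 2 := by
          have : 1 / X ≤ 1 / 2 := one_div_le_one_div_of_le (by norm_num) (hh.trans hhX)
          linarith
  calc _ ≤ |h⁻¹ * ∑ n ∈ Icc x (x + ⌊h⌋₊), f n| + |X⁻¹ * ∑ n ∈ Icc ⌈X⌉₊ ⌊2 * X⌋₊, f n| :=
        abs_sub _ _
    _ ≤ 3 := by linarith

/-- `log log h / log h ≥ -2` for `h ≥ 2` (`log h > 1/2`, `log log h ≥ log (1/2) ≥ -1`). [folklore] -/
theorem neg_two_le_loglog_div_log {h : ℝ} (hh : 2 ≤ h) :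
    -2 ≤ Real.log (Real.log h) / Real.log h := by
  have hl2 : (1 / 2 : ℝ) < Real.log 2 := by
    have := Real.log_two_gt_d9; linarith
  have hlh : Real.log 2 ≤ Real.log h := Real.log_le_log (by norm_num) hh
  have hlpos : 0 < Real.log h := by linarith
  have hll : -1 ≤ Real.log (Real.log h) := by
    have h1 : Real.log (1 / 2) ≤ Real.log (Real.log h) := Real.log_le_log (by norm_num) (by linarith)
    have h2 : Real.log (1 / 2) = -Real.log 2 := by
      rw [one_div, Real.log_inv]
    have h3 : Real.log 2 < 1 := by
      have := Real.log_two_lt_d9; linarith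
    linarith
  rw [le_div_iff₀ hlpos]
  nlinarith

/-- `1/h ≤ log log h / log h` once `log log h ≥ 1` (as `log h ≤ h`). [folklore] -/
theorem inv_le_loglog_div_log {h : ℝ} (hh : 1 < h) (hll : 1 ≤ Real.log (Real.log h)) :
    1 / h ≤ Real.log (Real.log h) / Real.log h := by
  have h0 : 0 < h := by linarith
  have hlpos : 0 < Real.log h := Real.log_pos hh
  have hlh : Real.log h ≤ h := (Real.log_le_sub_one_of_pos h0).trans (by linarith)
  calc 1 / h ≤ 1 / Real.log h := one_div_le_one_div_of_le hlpos hlh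
    _ ≤ Real.log (Real.log h) / Real.log h := by
        rw [div_le_div_iff_of_pos_right hlpos]; exact hll

/-- `√u / u³ ≤ log log h / log h` for `e ≤ log h ≤ u`, `log u ≥ 1` (`√u/u³ ≤ 1/u ≤ log u / u`, and
`t ↦ log t / t` decreases on `[e, ∞)`). [folklore] -/
theorem sqrt_div_cube_le_loglog_div_log {h u : ℝ} (hlh : Real.exp 1 ≤ Real.log h)
    (hu : Real.log h ≤ u) (hlu : 1 ≤ Real.log u) :
    Real.sqrt u / u ^ 3 ≤ Real.log (Real.log h) / Real.log h := by
  have he : 0 < Real.exp 1 := Real.exp_pos 1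
  have hlpos : 0 < Real.log h := by linarith
  have hu1 : 1 ≤ u := by
    have := Real.add_one_le_exp (1 : ℝ); linarith
  have hu0 : 0 < u := by linarith
  have h1 : Real.sqrt u / u ^ 3 ≤ 1 / u := by
    rw [div_le_div_iff₀ (by positivity) hu0]
    have hs : Real.sqrt u ≤ u := by
      rw [Real.sqrt_le_left (by linarith)]
      nlinarith
    calc Real.sqrt u * u ≤ u * u := mul_le_mul_of_nonneg_right hs hu0.le
      _ = 1 * u ^ 2 := by ring
      _ ≤ 1 * u ^ 3 := by
          rw [one_mul, one_mul]
          exact pow_le_pow_right₀ hu1 (by norm_num)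
  have h2 : 1 / u ≤ Real.log u / u := by
    rw [div_le_div_iff_of_pos_right hu0]; exact hlu
  have h3 : Real.log u / u ≤ Real.log (Real.log h) / Real.log h :=
    Real.log_div_self_antitoneOn hlh (hlh.trans hu) hu
  linarith

/-- `(1/2) ≤ (log h)^{1/3}` for `h ≥ 2` (`log 2 ≥ 1/8`). [folklore] -/
theorem half_le_log_rpow_third {h : ℝ} (hh : 2 ≤ h) : (1 / 2 : ℝ) ≤ Real.log h ^ (1 / 3 : ℝ) := by
  have hl : (1 / 8 : ℝ) ≤ Real.log h := by
    have := Real.log_two_gt_d9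
    have h2 : Real.log 2 ≤ Real.log h := Real.log_le_log (by norm_num) hh
    linarith
  have h18 : ((1 / 8 : ℝ)) ^ (1 / 3 : ℝ) = 1 / 2 := by
    rw [show (1 / 8 : ℝ) = (1 / 2) ^ 3 by norm_num, show (1 / 3 : ℝ) = ((3 : ℕ) : ℝ)⁻¹ by norm_num]
    exact Real.pow_rpow_inv_natCast (by norm_num) (by norm_num)
  calc (1 / 2 : ℝ) = (1 / 8 : ℝ) ^ (1 / 3 : ℝ) := h18.symm
    _ ≤ Real.log h ^ (1 / 3 : ℝ) := Real.rpow_le_rpow (by norm_num) hl (by norm_num)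

/-- `∑_{n ∈ s, n ∈ 𝒮} ζ(n) = ∑_{n ∈ s} 1_𝒮(n)`: on `𝒮` (which excludes `0`, as `J ≥ 1`) the
arithmetic function `ζ` is `1`. [folklore] -/
theorem sum_filter_mem_zeta {η X : ℝ} (I : SieveIntervalSystem η X) (s : Finset ℕ) :
    ∑ n ∈ s.filter I.Mem, ((ArithmeticFunction.zeta : ArithmeticFunction ℝ) n) =
      ∑ n ∈ s, (if I.Mem n then (1 : ℝ) else 0) := by
  rw [Finset.sum_filter]
  refine Finset.sum_congr rfl fun n _ => ?_
  by_cases hM : I.Mem n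
  · have hn : n ≠ 0 := by
      rintro rfl
      obtain ⟨p, hp, _⟩ := hM 1 (Finset.mem_Icc.mpr ⟨le_rfl, I.one_le_J⟩)
      simp at hp
    rw [if_pos hM, ArithmeticFunction.natCoe_apply, ArithmeticFunction.zeta_apply, if_neg hn]
    simp [hM]
  · rw [if_neg hM, if_neg hM]

/-- `|ζ(n)| ≤ 1`. [folklore] -/
theorem abs_zeta_le_one (n : ℕ) : |((ArithmeticFunction.zeta : ArithmeticFunction ℝ) n)| ≤ 1 := by
  rw [ArithmeticFunction.natCoe_apply, ArithmeticFunction.zeta_apply]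
  split_ifs <;> simp


/-! ### The main regime -/

set_option maxHeartbeats 1600000 in
/-- **The main regime of the deduction Theorem 3 ⇒ Theorem 1** (§9): for `2 ≤ h ≤ X`,
`(log X)^{-1/100} ≤ δ < 3` and `h, X` beyond explicit thresholds, with `Q_1 = min(h, exp √log X)`,
`P_1 = max(Q_1^{δ/4}… )` — precisely `log Q_1 = L = min(log h, √log X)`,
`log P_1 = p = max(δL/4, 30000 log L)` — and the system of choice (4), Theorem 3 (hypothesis `H3`,
`η = 1/150`, constant `C₃`, applied to `f` and to `1`) and the sieve bound (hypothesis `HB`) give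
`#{x : |A_f(x) - B_f| > δ + 120000 log log h / log h} ≤ (1600 C₃⁺ + 1) X ((log h)^{1/3}/(δ² h^{δ/25}) + 1/(δ² (log X)^{1/50}))`.
[cite: MatomakiRadziwillAnnals2016, §9 (proof of Theorem 1)] -/
theorem main_estimate {C₃ X₃ : ℝ}
    (H3 : ∀ f : ArithmeticFunction ℝ, f.IsMultiplicative → (∀ n, |f n| ≤ 1) →
      ∀ X h : ℝ, X₃ ≤ X → h ≤ X → ∀ I : SieveIntervalSystem (1 / 150) X, I.Q 1 ≤ h →
        X⁻¹ * ∫ x in X..2 * X,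
            (h⁻¹ * ∑ n ∈ (Icc ⌈x⌉₊ ⌊x + h⌋₊).filter I.Mem, f n
              - X⁻¹ * ∑ n ∈ (Icc ⌈X⌉₊ ⌊2 * X⌋₊).filter I.Mem, f n) ^ 2
          ≤ C₃ * (Real.log h ^ (1 / 3 : ℝ) / I.P 1 ^ (1 / 6 - 1 / 150 : ℝ)
              + 1 / Real.log X ^ (1 / 50 : ℝ)))
    {X_B P₀ : ℝ} (hP₀ : 2 ≤ P₀)
    (HB : ∀ X P Q : ℝ, X_B ≤ X → P₀ ≤ P → P ≤ Q → Q ≤ Real.exp (Real.sqrt (Real.log X)) →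
      (#{n ∈ Icc ⌈X⌉₊ ⌊2 * X⌋₊ | ∀ q ∈ (Icc ⌈P⌉₊ ⌊Q⌋₊).filter Nat.Prime, ¬ q ∣ n} : ℝ) ≤
        (1 + 1 / 100) * X * (Real.log P / Real.log Q) + X / Real.log X ^ 3)
    (f : ArithmeticFunction ℝ) (hf : f.IsMultiplicative) (hf1 : ∀ n, |f n| ≤ 1)
    {h X δ : ℝ} (hh : 2 ≤ h) (hhX : h ≤ X) (hδ : 0 < δ) (hδ3 : δ < 3)
    (hX3 : X₃ ≤ X) (hXB : X_B ≤ X)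
    (hLh : 1 ≤ Real.log (Real.log h) ∧ 30000 * Real.log (Real.log h) ≤ Real.log h / 4 ∧
      Real.log P₀ ≤ 30000 * Real.log (Real.log h))
    (hsu : 1 ≤ Real.log (Real.sqrt (Real.log X)) ∧
      30000 * Real.log (Real.sqrt (Real.log X)) ≤ Real.sqrt (Real.log X) / 4 ∧
      Real.log P₀ ≤ 30000 * Real.log (Real.sqrt (Real.log X)))
    (hu4 : 60000 * Real.log (Real.log X) ≤ Real.log X ^ (49 / 100 : ℝ))
    (hu5 : Real.log X ^ (1 / 3 + 1 / 50 : ℝ) ≤ Real.exp (Real.log X ^ (49 / 100 : ℝ) / 25))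
    (hu6 : 18 * Real.log X ^ (1 / 50 : ℝ) ≤ X) (hllX : 1 ≤ Real.log (Real.log X))
    (hδu : Real.log X ^ (-(1 / 100) : ℝ) ≤ δ) :
    (#{x ∈ Icc ⌈X⌉₊ ⌊2 * X⌋₊ |
        δ + 120000 * Real.log (Real.log h) / Real.log h <
          |h⁻¹ * ∑ n ∈ Icc x (x + ⌊h⌋₊), f n - X⁻¹ * ∑ n ∈ Icc ⌈X⌉₊ ⌊2 * X⌋₊, f n|} : ℝ)
      ≤ (1600 * max C₃ 0 + 1) * X *
          (Real.log h ^ (1 / 3 : ℝ) / (δ ^ 2 * h ^ (δ / 25))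
            + 1 / (δ ^ 2 * Real.log X ^ (1 / 50 : ℝ))) := by
  obtain ⟨hLh1, hLh2, hLh3⟩ := hLh
  obtain ⟨hsu1, hsu2, hsu3⟩ := hsu
  have h0 : 0 < h := by linarith
  have h1 : (1 : ℝ) < h := by linarith
  have hX0 : 0 < X := by linarith
  have hX1 : (1 : ℝ) ≤ X := by linarith
  set u := Real.log X with hu_def
  have hLh_pos : 0 < Real.log h := Real.log_pos h1
  have hLh_e : Real.exp 1 ≤ Real.log h := by
    have := Real.exp_le_exp.mpr hLh1
    rwa [Real.exp_log hLh_pos] at this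
  have hLh_u : Real.log h ≤ u := Real.log_le_log h0 hhX
  have hu_pos : 0 < u := by linarith
  have hsu_pos : 0 < Real.sqrt u := by
    by_contra hc
    push Not at hc
    have : Real.sqrt u = 0 := le_antisymm hc (Real.sqrt_nonneg u)
    rw [this, Real.log_zero] at hsu1
    linarith
  set L := min (Real.log h) (Real.sqrt u) with hL_def
  have hL_pos : 0 < L := lt_min hLh_pos hsu_pos
  have hL_Lh : L ≤ Real.log h := min_le_left _ _
  have hL_su : L ≤ Real.sqrt u := min_le_right _ _
  have hLc : 1 ≤ Real.log L ∧ 30000 * Real.log L ≤ L / 4 ∧ Real.log P₀ ≤ 30000 * Real.log L := by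
    rcases min_choice (Real.log h) (Real.sqrt u) with hm | hm
    · rw [hL_def, hm]; exact ⟨hLh1, hLh2, hLh3⟩
    · rw [hL_def, hm]; exact ⟨hsu1, hsu2, hsu3⟩
  obtain ⟨hL1, hL2, hL3⟩ := hLc
  set p := max (δ * L / 4) (30000 * Real.log L) with hp_def
  have hpδ : δ * L / 4 ≤ p := le_max_left _ _
  have hpK : 30000 * Real.log L ≤ p := le_max_right _ _
  have hpL : p ≤ L := by
    refine max_le ?_ (by linarith)
    have : δ * L ≤ 4 * L := mul_le_mul_of_nonneg_right (by linarith) hL_pos.le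
    linarith
  have hP₀p : Real.log P₀ ≤ p := hL3.trans hpK
  have hLX : L ≤ Real.sqrt (Real.log X) := hL_su
  set I := ofChoice X L p hL1 hpK hpL hLX with hI_def
  have hQ1 : I.Q 1 ≤ h := by
    rw [hI_def, ofChoice_Q_one]
    calc Real.exp L ≤ Real.exp (Real.log h) := Real.exp_le_exp.mpr hL_Lh
      _ = h := Real.exp_log h0
  have hP1 : I.P 1 = Real.exp p := by rw [hI_def, ofChoice_P_one]
  -- Theorem 3, twice
  have H3f := H3 f hf hf1 X h hX3 hhX I hQ1
  have H3u := H3 (ArithmeticFunction.zeta : ArithmeticFunction ℝ)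
    ArithmeticFunction.isMultiplicative_zeta.natCast abs_zeta_le_one X h hX3 hhX I hQ1
  simp_rw [Finset.sum_filter] at H3f
  simp_rw [sum_filter_mem_zeta] at H3u
  rw [hP1] at H3f H3u
  -- the factor `R ≤ A' + 2 B'`
  set A' := Real.log h ^ (1 / 3 : ℝ) / h ^ (δ / 25) with hA'_def
  set B' := 1 / u ^ (1 / 50 : ℝ) with hB'_def
  have hA'0 : 0 ≤ A' := by positivity
  have hB'0 : 0 ≤ B' := by positivity
  set R := Real.log h ^ (1 / 3 : ℝ) / Real.exp p ^ (1 / 6 - 1 / 150 : ℝ) + 1 / u ^ (1 / 50 : ℝ)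
    with hR_def
  have hRnn : 0 ≤ R := by positivity
  have hR : R ≤ A' + 2 * B' := by
    have := logh_rpow_div_le hL_def hpδ h1 hLh_u hδu hu5
    rw [hR_def, hA'_def, hB'_def]
    linarith
  set C := max C₃ 0 with hC_def
  have hC0 : 0 ≤ C := le_max_right _ _
  have hC3 : C₃ ≤ C := le_max_left _ _
  set M := X * (C * (A' + 2 * B')) with hM_def
  have key : ∀ T : ℝ, X⁻¹ * T ≤ C₃ * R → T ≤ M := by
    intro T hT
    have h2 : X⁻¹ * T ≤ C * (A' + 2 * B') := by
      refine hT.trans ?_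
      calc C₃ * R ≤ C * R := mul_le_mul_of_nonneg_right hC3 hRnn
        _ ≤ C * (A' + 2 * B') := mul_le_mul_of_nonneg_left hR hC0
    have := mul_le_mul_of_nonneg_left h2 hX0.le
    rwa [← mul_assoc, mul_inv_cancel₀ hX0.ne', one_mul] at this
  have hMf := key _ H3f
  have hMu := key _ H3u
  -- the sieve
  have hσ := inv_mul_card_not_mem_le hL1 hpK hpL hLX (by linarith : (0 : ℝ) < P₀) HB hXB hX1 hP₀p
  -- `p / L`
  have hcase2 : Real.sqrt u < Real.log h → 30000 * Real.log L ≤ δ * L / 4 := by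
    intro hlt
    have hLeq : L = Real.sqrt u := by rw [hL_def, min_eq_right hlt.le]
    rw [hLeq, Real.log_sqrt hu_pos.le]
    have h49 : u ^ (49 / 100 : ℝ) ≤ δ * Real.sqrt u := by
      rw [Real.sqrt_eq_rpow, show (49 / 100 : ℝ) = -(1 / 100) + 1 / 2 by norm_num,
        Real.rpow_add hu_pos]
      exact mul_le_mul_of_nonneg_right hδu (Real.rpow_nonneg hu_pos.le _)
    linarith
  have hlogh1 : 1 ≤ Real.log h := by
    have := Real.add_one_le_exp (1 : ℝ); linarith
  have hpL' := p_div_L_le hL_def hp_def hL_pos hδ.le hlogh1 hcase2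
  -- the threshold
  set ℓ := Real.log (Real.log h) / Real.log h with hℓ_def
  have hℓ0 : 0 ≤ ℓ := div_nonneg (by linarith) hLh_pos.le
  have hℓ1 : 1 / h ≤ ℓ := inv_le_loglog_div_log h1 hLh1
  have hℓ2 : Real.sqrt u / u ^ 3 ≤ ℓ := sqrt_div_cube_le_loglog_div_log hLh_e hLh_u hllX
  have ht0 : 0 < δ / 20 := by positivity
  have hτ : 2 * (δ / 20) + 6 / h + 2 * ((1 + 1 / 100) * (7 / 4) * (p / L) + Real.sqrt u / u ^ 3)
      ≤ δ + 120000 * Real.log (Real.log h) / Real.log h := by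
    rw [mul_div_assoc, ← hℓ_def]
    have e6 : 6 / h ≤ 6 * ℓ := by
      have : 6 / h = 6 * (1 / h) := by ring
      rw [this]; linarith
    have e7 : 2 * ((1 + 1 / 100) * (7 / 4) * (p / L)) ≤ 2 * ((1 + 1 / 100) * (7 / 4) * (δ / 4 + 30000 * ℓ)) := by
      have : (0 : ℝ) ≤ (1 + 1 / 100) * (7 / 4) := by norm_num
      nlinarith [hpL']
    linarith [e6, e7, hℓ2, hℓ0, hδ.le]
  -- count
  have hcount := card_exceptions_le_of_meanSquare I.Mem (fun n => f n) hf1 hh hhX ht0 hσ hτ hMf hMu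
  -- final arithmetic
  have hhδ : h ^ (δ / 25) ≠ 0 := (Real.rpow_pos_of_pos h0 _).ne'
  have hu50 : u ^ (1 / 50 : ℝ) ≠ 0 := (Real.rpow_pos_of_pos hu_pos _).ne'
  have hδ0 : δ ≠ 0 := hδ.ne'
  set P := X / δ ^ 2 * A' with hP_def
  set Q := X / δ ^ 2 * B' with hQ_def
  have hPnn : 0 ≤ P := by positivity
  have hCP : 0 ≤ C * P := mul_nonneg hC0 hPnn
  have hQ2 : 2 ≤ Q := by
    rw [hQ_def, hB'_def]
    have hδ2 : δ ^ 2 ≤ 9 := by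
      have := pow_le_pow_left₀ hδ.le hδ3.le 2
      norm_num at this
      exact this
    have hupos : 0 < u ^ (1 / 50 : ℝ) := Real.rpow_pos_of_pos hu_pos _
    rw [div_mul_div_comm, mul_one, le_div_iff₀ (by positivity)]
    calc 2 * (δ ^ 2 * u ^ (1 / 50 : ℝ)) ≤ 2 * (9 * u ^ (1 / 50 : ℝ)) := by gcongr
      _ = 18 * u ^ (1 / 50 : ℝ) := by ring
      _ ≤ X := hu6
  have eq1 : ((δ / 20) ^ 2)⁻¹ * (M + M) + 2 = 800 * (C * P) + 1600 * (C * Q) + 2 := by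
    rw [hM_def, hP_def, hQ_def]
    field_simp
    ring
  calc _ ≤ ((δ / 20) ^ 2)⁻¹ * (M + M) + 2 := hcount
    _ = 800 * (C * P) + 1600 * (C * Q) + 2 := eq1
    _ ≤ 1600 * (C * P) + 1600 * (C * Q) + P + Q := by linarith
    _ = _ := by
        rw [hP_def, hQ_def, hA'_def, hB'_def]
        field_simp
        ring


/-! ### "For all large `h`" and "for all large `X`" -/

/-- The conditions on `L = log Q_1` hold for all large `L`. [folklore] -/
theorem eventually_largeL (P₀ : ℝ) : ∀ᶠ L : ℝ in atTop,
    1 ≤ Real.log L ∧ 30000 * Real.log L ≤ L / 4 ∧ Real.log P₀ ≤ 30000 * Real.log L := by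
  have h1 : ∀ᶠ L : ℝ in atTop, 1 ≤ Real.log L := Real.tendsto_log_atTop.eventually_ge_atTop 1
  have h2 : ∀ᶠ L : ℝ in atTop, 30000 * Real.log L ≤ L / 4 := by
    have hb := Real.isLittleO_log_id_atTop.bound (show (0 : ℝ) < 1 / 120000 by norm_num)
    filter_upwards [hb, eventually_ge_atTop (1 : ℝ)] with L hL hL1
    have hL' : |Real.log L| ≤ 1 / 120000 * |L| := by simpa using hL
    rw [abs_of_nonneg (Real.log_nonneg hL1), abs_of_nonneg (by linarith)] at hL'
    linarith
  have h3 : ∀ᶠ L : ℝ in atTop, Real.log P₀ ≤ 30000 * Real.log L := by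
    filter_upwards [Real.tendsto_log_atTop.eventually_ge_atTop (Real.log P₀ / 30000)] with L hL
    linarith
  filter_upwards [h1, h2, h3] with L a b c using ⟨a, b, c⟩

/-- The conditions on `X` (and on `h`, which is at most `X`) hold for all large reals. [folklore] -/
theorem eventually_largeX (X₃ X_B L₀ : ℝ) : ∀ᶠ Y : ℝ in atTop,
    (2 ≤ Y ∧ X₃ ≤ Y ∧ X_B ≤ Y) ∧ (L₀ ≤ Real.log Y ∧ L₀ ≤ Real.sqrt (Real.log Y)) ∧
    60000 * Real.log (Real.log Y) ≤ Real.log Y ^ (49 / 100 : ℝ) ∧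
    Real.log Y ^ (1 / 3 + 1 / 50 : ℝ) ≤ Real.exp (Real.log Y ^ (49 / 100 : ℝ) / 25) ∧
    18 * Real.log Y ^ (1 / 50 : ℝ) ≤ Y ∧ 1 ≤ Real.log (Real.log Y) := by
  have h1 : ∀ᶠ Y : ℝ in atTop, 2 ≤ Y ∧ X₃ ≤ Y ∧ X_B ≤ Y := by
    filter_upwards [eventually_ge_atTop (2 : ℝ), eventually_ge_atTop X₃, eventually_ge_atTop X_B]
      with Y a b c using ⟨a, b, c⟩
  have h2 : ∀ᶠ Y : ℝ in atTop, L₀ ≤ Real.log Y ∧ L₀ ≤ Real.sqrt (Real.log Y) := by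
    filter_upwards [Real.tendsto_log_atTop.eventually_ge_atTop L₀,
      Real.tendsto_log_atTop.eventually_ge_atTop (L₀ ^ 2)] with Y hY hY2
    refine ⟨hY, ?_⟩
    calc L₀ ≤ |L₀| := le_abs_self L₀
      _ = Real.sqrt (L₀ ^ 2) := (Real.sqrt_sq_eq_abs L₀).symm
      _ ≤ Real.sqrt (Real.log Y) := Real.sqrt_le_sqrt hY2
  have h3u : ∀ᶠ u : ℝ in atTop, 60000 * Real.log u ≤ u ^ (49 / 100 : ℝ) := by
    have hb := (isLittleO_log_rpow_atTop (show (0 : ℝ) < 49 / 100 by norm_num)).bound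
      (show (0 : ℝ) < 1 / 60000 by norm_num)
    filter_upwards [hb, eventually_ge_atTop (1 : ℝ)] with u hu hu1
    rw [Real.norm_of_nonneg (Real.log_nonneg hu1),
      Real.norm_of_nonneg (Real.rpow_nonneg (by linarith) _)] at hu
    linarith
  have h3 : ∀ᶠ Y : ℝ in atTop, 60000 * Real.log (Real.log Y) ≤ Real.log Y ^ (49 / 100 : ℝ) :=
    Real.tendsto_log_atTop.eventually h3u
  have h4u : ∀ᶠ u : ℝ in atTop, u ^ (1 / 3 + 1 / 50 : ℝ) ≤ Real.exp (u ^ (49 / 100 : ℝ) / 25) := by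
    have hb := (isLittleO_log_rpow_atTop (show (0 : ℝ) < 49 / 100 by norm_num)).bound
      (show (0 : ℝ) < 1 / 10 by norm_num)
    filter_upwards [hb, eventually_ge_atTop (1 : ℝ)] with u hu hu1
    have hu0 : 0 < u := by linarith
    rw [Real.norm_of_nonneg (Real.log_nonneg hu1),
      Real.norm_of_nonneg (Real.rpow_nonneg hu0.le _)] at hu
    rw [Real.rpow_def_of_pos hu0]
    apply Real.exp_le_exp.mpr
    have h49 : 0 ≤ u ^ (49 / 100 : ℝ) := Real.rpow_nonneg hu0.le _
    nlinarith
  have h4 : ∀ᶠ Y : ℝ in atTop,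
      Real.log Y ^ (1 / 3 + 1 / 50 : ℝ) ≤ Real.exp (Real.log Y ^ (49 / 100 : ℝ) / 25) :=
    Real.tendsto_log_atTop.eventually h4u
  have h5 : ∀ᶠ Y : ℝ in atTop, 18 * Real.log Y ^ (1 / 50 : ℝ) ≤ Y := by
    have hb := Real.isLittleO_log_id_atTop.bound (show (0 : ℝ) < 1 / 18 by norm_num)
    filter_upwards [hb, eventually_ge_atTop (Real.exp 1)] with Y hY hYe
    have hY0 : 0 < Y := (Real.exp_pos 1).trans_le hYe
    have hY1 : 1 ≤ Real.log Y := by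
      rw [← Real.log_exp 1]; exact Real.log_le_log (Real.exp_pos 1) hYe
    have hlog_le : Real.log Y ^ (1 / 50 : ℝ) ≤ Real.log Y := by
      calc Real.log Y ^ (1 / 50 : ℝ) ≤ Real.log Y ^ (1 : ℝ) :=
            Real.rpow_le_rpow_of_exponent_le hY1 (by norm_num)
        _ = Real.log Y := Real.rpow_one _
    have hY' : |Real.log Y| ≤ 1 / 18 * |Y| := by simpa using hY
    rw [abs_of_nonneg (by linarith), abs_of_nonneg hY0.le] at hY'
    linarith
  have h6 : ∀ᶠ Y : ℝ in atTop, 1 ≤ Real.log (Real.log Y) :=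
    (Real.tendsto_log_atTop.comp Real.tendsto_log_atTop).eventually_ge_atTop 1
  filter_upwards [h1, h2, h3, h4, h5, h6] with Y a b c d e g using ⟨a, b, c, d, e, g⟩

/-! ### Theorem 3 ⇒ Theorem 1 -/

/-- **Matomäki–Radziwiłł 2016, Theorem 1 from Theorem 3** (§9 of the paper, PROVED here): the
named fact `MatomakiRadziwill2016_theorem3` implies the named fact `MatomakiRadziwill2016_theorem1`,
with `C' = 120000` and some absolute `C`.  The proof follows §9: separate `n ∉ 𝒮`
(`abs_sub_le_separate`), bound the two `𝒮`-restricted deviations in mean square by Theorem 3 (for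
`f` and for `1`) and count bad integers by Chebyshev (`card_exceptions_le_of_meanSquare`), bound
`#{n ∉ 𝒮}` by the sieve (`inv_mul_card_not_mem_le`, from Brun's pure sieve and Mertens' product
bound), with the intervals of choice (4) built from `Q_1 = min(h, exp √log X)`,
`P_1 = max(Q_1^{δ/4}, (log Q_1)^{30000})`, `η = 1/150` (`main_estimate`); the finitely many
degenerate regimes (`δ ≥ 3 + 2C'`: no exceptions; `h` small; `δ ≥ 3` with `h` large: no exceptions;
`δ < (log X)^{-1/100}`: the bound exceeds `X`) are absorbed into `C`.
[cite: MatomakiRadziwillAnnals2016, Theorem 1 and §9] -/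
theorem theorem1_of_theorem3 (h3 : MatomakiRadziwill2016_theorem3)
    {X_B P₀ : ℝ} (hP₀ : 2 ≤ P₀)
    (HB : ∀ X P Q : ℝ, X_B ≤ X → P₀ ≤ P → P ≤ Q → Q ≤ Real.exp (Real.sqrt (Real.log X)) →
      (#{n ∈ Icc ⌈X⌉₊ ⌊2 * X⌋₊ | ∀ q ∈ (Icc ⌈P⌉₊ ⌊Q⌋₊).filter Nat.Prime, ¬ q ∣ n} : ℝ) ≤
        (1 + 1 / 100) * X * (Real.log P / Real.log Q) + X / Real.log X ^ 3) :
    MatomakiRadziwill2016_theorem1 := by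
  obtain ⟨C₃, X₃, H3⟩ := h3 (1 / 150) (by norm_num) (by norm_num)
  obtain ⟨L₀, hL₀⟩ := Filter.eventually_atTop.mp (eventually_largeL P₀)
  obtain ⟨Y₀, hY₀⟩ := Filter.eventually_atTop.mp (eventually_largeX X₃ X_B L₀)
  set h₀ : ℝ := max Y₀ 2 with hh₀
  have hh₀2 : 2 ≤ h₀ := le_max_right _ _
  have hh₀Y : Y₀ ≤ h₀ := le_max_left _ _
  have hh₀1 : 1 ≤ h₀ := by linarith
  set δ₁ : ℝ := 3 + 2 * 120000 with hδ₁
  set Ct : ℝ := 3 * δ₁ ^ 2 * h₀ ^ (δ₁ / 25) with hCt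
  set C : ℝ := max (max (1600 * max C₃ 0 + 1) Ct) 2 with hC
  have hC1 : 1600 * max C₃ 0 + 1 ≤ C := (le_max_left _ _).trans (le_max_left _ _)
  have hC2 : Ct ≤ C := (le_max_right _ _).trans (le_max_left _ _)
  have hC3 : 2 ≤ C := le_max_right _ _
  refine ⟨C, 120000, by linarith, by norm_num, ?_⟩
  intro f hf hf1 h X δ hh hhX hδ
  have hX2 : 2 ≤ X := hh.trans hhX
  have hX0 : 0 < X := by linarith
  have h0 : 0 < h := by linarith
  have h1 : (1 : ℝ) < h := by linarith
  have hlogh : 0 < Real.log h := Real.log_pos h1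
  have hlogX : 0 < Real.log X := Real.log_pos (by linarith)
  -- the two terms of the bound are nonnegative
  set A := Real.log h ^ (1 / 3 : ℝ) / (δ ^ 2 * h ^ (δ / 25)) with hA
  set B := 1 / (δ ^ 2 * Real.log X ^ (1 / 50 : ℝ)) with hB
  have hden1 : 0 < δ ^ 2 * h ^ (δ / 25) := by positivity
  have hden2 : 0 < δ ^ 2 * Real.log X ^ (1 / 50 : ℝ) :=
    mul_pos (by positivity) (Real.rpow_pos_of_pos hlogX _)
  have hA0 : 0 ≤ A := div_nonneg (Real.rpow_nonneg hlogh.le _) hden1.le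
  have hB0 : 0 ≤ B := div_nonneg zero_le_one hden2.le
  have hCXAB : 0 ≤ C * X * (A + B) := by positivity
  -- the exceptional set and its trivial bound
  set exc := {x ∈ Icc ⌈X⌉₊ ⌊2 * X⌋₊ |
      δ + 120000 * Real.log (Real.log h) / Real.log h <
        |h⁻¹ * ∑ n ∈ Icc x (x + ⌊h⌋₊), f n - X⁻¹ * ∑ n ∈ Icc ⌈X⌉₊ ⌊2 * X⌋₊, f n|} with hexc
  have htriv : (#exc : ℝ) ≤ 3 / 2 * X := by
    calc (#exc : ℝ) ≤ #(Icc ⌈X⌉₊ ⌊2 * X⌋₊) := by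
          exact_mod_cast Finset.card_le_card (Finset.filter_subset _ _)
      _ ≤ 3 / 2 * X := card_long_le' hX2
  have hnoexc : 3 ≤ δ + 120000 * Real.log (Real.log h) / Real.log h → (#exc : ℝ) = 0 := by
    intro hτ
    have : exc = ∅ := by
      rw [hexc, Finset.filter_eq_empty_iff]
      intro x _
      exact not_lt.mpr ((abs_avg_sub_avg_le_three f hf1 hh hhX x).trans hτ)
    rw [this, Finset.card_empty, Nat.cast_zero]
  -- Regime 1: `δ ≥ 3 + 2 C'` — no exceptions
  by_cases hδ₁' : δ₁ ≤ δ
  · have hℓ := neg_two_le_loglog_div_log hh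
    have : 3 ≤ δ + 120000 * Real.log (Real.log h) / Real.log h := by
      rw [mul_div_assoc]; rw [hδ₁] at hδ₁'; linarith
    rw [hnoexc this]
    exact hCXAB
  push Not at hδ₁'
  -- Regime 2: `h < h₀` — trivial bound through the first term
  by_cases hhh₀ : h < h₀
  · have hAlow : (1 / 2) / (δ₁ ^ 2 * h₀ ^ (δ₁ / 25)) ≤ A := by
      rw [hA]
      have hnum := half_le_log_rpow_third hh
      have hden : δ ^ 2 * h ^ (δ / 25) ≤ δ₁ ^ 2 * h₀ ^ (δ₁ / 25) := by
        have e1 : δ ^ 2 ≤ δ₁ ^ 2 := pow_le_pow_left₀ hδ.le hδ₁'.le 2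
        have e2 : h ^ (δ / 25) ≤ h₀ ^ (δ₁ / 25) :=
          calc h ^ (δ / 25) ≤ h₀ ^ (δ / 25) := Real.rpow_le_rpow h0.le hhh₀.le (by positivity)
            _ ≤ h₀ ^ (δ₁ / 25) := Real.rpow_le_rpow_of_exponent_le hh₀1 (by linarith)
        exact mul_le_mul e1 e2 (Real.rpow_nonneg h0.le _) (by positivity)
      exact div_le_div₀ (Real.rpow_nonneg hlogh.le _) hnum hden1 hden
    have hCtA : 3 / 2 ≤ Ct * A := by
      have hpos : 0 < δ₁ ^ 2 * h₀ ^ (δ₁ / 25) := by positivity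
      calc (3 / 2 : ℝ) = Ct * ((1 / 2) / (δ₁ ^ 2 * h₀ ^ (δ₁ / 25))) := by
            rw [hCt]; field_simp
        _ ≤ Ct * A := mul_le_mul_of_nonneg_left hAlow (by positivity)
    have e3 : C * A * X ≤ C * X * (A + B) := by
      have : C * X * A ≤ C * X * (A + B) :=
        mul_le_mul_of_nonneg_left (by linarith) (by positivity)
      linarith [show C * A * X = C * X * A by ring]
    calc (#exc : ℝ) ≤ 3 / 2 * X := htriv
      _ ≤ Ct * A * X := mul_le_mul_of_nonneg_right hCtA hX0.le
      _ ≤ C * A * X := by gcongr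
      _ ≤ C * X * (A + B) := e3
  push Not at hhh₀
  -- `h ≥ h₀`: the largeness conditions at `h` and at `X`
  have hYh := hY₀ h (hh₀Y.trans hhh₀)
  have hYX := hY₀ X (hh₀Y.trans (hhh₀.trans hhX))
  obtain ⟨-, ⟨hL₀h, -⟩, -, -, -, hllh⟩ := hYh
  obtain ⟨⟨-, hX3, hXB⟩, ⟨-, hL₀X⟩, hu4, hu5, hu6, hllX⟩ := hYX
  -- Regime 3: `δ ≥ 3` — no exceptions
  by_cases hδ3 : 3 ≤ δ
  · have hℓ : 0 ≤ Real.log (Real.log h) / Real.log h := div_nonneg (by linarith) hlogh.le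
    have : 3 ≤ δ + 120000 * Real.log (Real.log h) / Real.log h := by
      rw [mul_div_assoc]; linarith
    rw [hnoexc this]
    exact hCXAB
  push Not at hδ3
  -- Regime 4: `δ < (log X)^{-1/100}` — the second term exceeds `1`
  by_cases hδu : δ < Real.log X ^ (-(1 / 100) : ℝ)
  · have hB1 : 1 ≤ B := by
      rw [hB, le_div_iff₀ hden2, one_mul]
      have hδ2 : δ ^ 2 < Real.log X ^ (-(1 / 50) : ℝ) := by
        calc δ ^ 2 < (Real.log X ^ (-(1 / 100) : ℝ)) ^ 2 := pow_lt_pow_left₀ hδu hδ.le two_ne_zero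
          _ = Real.log X ^ (-(1 / 50) : ℝ) := by
              rw [← Real.rpow_natCast, ← Real.rpow_mul hlogX.le]; norm_num
      have hpos : 0 < Real.log X ^ (1 / 50 : ℝ) := Real.rpow_pos_of_pos hlogX _
      calc δ ^ 2 * Real.log X ^ (1 / 50 : ℝ) ≤ Real.log X ^ (-(1 / 50) : ℝ) * Real.log X ^ (1 / 50 : ℝ) :=
            mul_le_mul_of_nonneg_right hδ2.le hpos.le
        _ = 1 := by rw [← Real.rpow_add hlogX]; norm_num
    have e1 : 2 * X ≤ C * X := mul_le_mul_of_nonneg_right hC3 hX0.le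
    have e2 : C * X * 1 ≤ C * X * B := mul_le_mul_of_nonneg_left hB1 (by positivity)
    have e3 : C * X * B ≤ C * X * (A + B) :=
      mul_le_mul_of_nonneg_left (by linarith) (by positivity)
    linarith
  push Not at hδu
  -- Regime 5: the main regime
  have hmain := main_estimate H3 hP₀ HB f hf hf1 hh hhX hδ hδ3 hX3 hXB (hL₀ _ hL₀h) (hL₀ _ hL₀X)
    hu4 hu5 hu6 hllX hδu
  calc (#exc : ℝ) ≤ (1600 * max C₃ 0 + 1) * X * (A + B) := hmain
    _ ≤ C * X * (A + B) := by gcongr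

end MatomakiRadziwillThm1

/-- **Matomäki–Radziwiłł 2016: Theorem 3 implies Theorem 1** (§9), with the sieve input
discharged by `Literature.NumberTheory.Sieve.IntervalSieve.card_Icc_filter_forall_prime_not_dvd_le` (Brun's pure sieve and
Mertens' product bound, both proved).  Hence `MatomakiRadziwill2016_theorem1`, and with it
`matomaki_radziwill` (`matomaki_radziwill_of_theorem1`), is reduced to the named fact
`MatomakiRadziwill2016_theorem3`. [cite: MatomakiRadziwillAnnals2016, Theorem 1 and §9] -/
theorem MatomakiRadziwill2016_theorem1_of_theorem3 (h3 : MatomakiRadziwill2016_theorem3) :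
    MatomakiRadziwill2016_theorem1 := by
  obtain ⟨X_B, P₀, hP₀, HB⟩ :=
    Literature.NumberTheory.Sieve.IntervalSieve.card_Icc_filter_forall_prime_not_dvd_le (1 / 100) (by norm_num)
  exact MatomakiRadziwillThm1.theorem1_of_theorem3 h3 hP₀ HB

/-- `matomaki_radziwill` (parity.S38) from Theorem 3 of Matomäki–Radziwiłł.
[cite: MatomakiRadziwillAnnals2016, Theorems 1, 3 and §9] -/
theorem matomaki_radziwill_of_theorem3 (h3 : MatomakiRadziwill2016_theorem3) : matomaki_radziwill :=
  matomaki_radziwill_of_theorem1 (MatomakiRadziwill2016_theorem1_of_theorem3 h3)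

end Literature.NumberTheory.Sieve
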